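import Summits.CriticalPhenomena.Ising3DConformalLimit.Theses.GaussianScaleMixture
import Literature.Barriers.CriticalPhenomena.ScaleCovarianceNotMoebius
import Literature.Barriers.CriticalPhenomena.TwoPointLawNotMoebius
import Literature.Probability.LatticeModels.CriticalWickDichotomy
import Literature.Probability.LatticeModels.CriticalScalingDimension
import Literature.Probability.LatticeModels.ScalingLimit3D
import Literature.Probability.LatticeModels.CriticalUrsellFourSign
import Literature.Probability.LatticeModels.CriticalCorrWellDefined
import Literature.Probability.LatticeModels.GKSInequalities
import Literature.MathematicalPhysics.QuantumFieldTheory.PointwiseOSReconstruction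
import Summits.CriticalPhenomena.Ising3DConformalLimit.Theorems.MoebiusLimitExists.Negative.FreeReflections
import Summits.CriticalPhenomena.Ising3DConformalLimit.Theorems.MoebiusLimitExists.Negative.ScaleRedundant
import Summits.CriticalPhenomena.Ising3DConformalLimit.Theorems.MoebiusLimitExists.Negative.RotationFromInversion

/-!
# Disproof of `RotationUpgradeFromTwoPoint` (item stmt-CriticalPhenomena-8367) — findings

Work file of the STANDING CRUX DISPROVER (cdisprove, cycles 1–2, 2026-08-16; v5). Crux (route decl
`GaussianScaleMixture.RotationUpgradeFromTwoPoint`, rank 4 of route GaussianScaleMixture; the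
n-point half of the isotropy problem, consumable by HyperoctahedralRP as well):

  ∀ ρ Δ S, (H1) ρ > 0 on (0,1] → (H2) HasPointwiseScalingLimit (criticalCorr 3) ρ S →
    (H3) S = 0 off NonCoincident → (H4) IsNondegenerateTwoPoint S → (H5) IsTranslationInvariant S →
    (H6) IsScaleCovariant Δ S → (H7) (∀ R x, x ≠ 0 → S 2 ![0, R x] = S 2 ![0, x]) →
    IsRotationInvariant S.

VERDICT SO FAR: **resists** (no kill). (H2)+(H3) pin `S` completely — on `NonCoincident` it is the
locally uniform limit of the ACTUAL critical Ising correlators (`criticalCorr 3` = `limUnder` of box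
Gibbs expectations, a genuine object, no junk value reachable), off it `0`; the conclusion quantifies
over linear isometries, which preserve `NonCoincident`. There is NO junk instance: a counterexample
would have to be the Ising₃ scaling limit itself, shown to exist with round `S₂` and NOT `O(3)`
invariant at some even order `n ≥ 4` in its CONNECTED part (§1–§2). Physics expects the opposite
(rotation restoration with correction exponent `ω_NR ≈ 2.02`, arXiv:2105.09781), and no construction
of the limit exists (Duminil-Copin ICM 2022 §8.4). Everything below is `lean check` rc 0 with NO
`sorry` unless marked as a near-miss.

## Findings (index)

* §0 READ-BACK — `Crux`, `Hyp` (H1–H7 bundled, `TwoPointIsotropic` = H7), `crux_iff`.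
* §1 AUTOMATIC / FREE / REDUNDANT —
  orders `0`, odd (`m*(β_c)=0`, tree `HasPointwiseScalingLimit.eq_zero_of_odd` + H3) and `2`
  (MODEL-BLIND from H5+H7: `two_point_rot`, coincident pairs included) are automatic
  ⇒ `crux_iff_evenFromFour`;
  the hyperoctahedral group `B₃` and `-1` act trivially on ANY limit (tree `limit_coordPerm`,
  `limit_signFlip`, `limit_neg`) ⇒ `cubicInvariant_free`, `neg_free`, `rot_iff_negRot`: the crux is
  about `SO(3)` modulo `B₃` only;
  (H5) is REDUNDANT (`translation_redundant`, tree `isTranslationInvariant_normalised_of_limit`) and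
  (H6)+`Δ` are REDUNDANT (`scale_redundant`, tree `exists_scaleCovariant_normalised`)
  ⇒ `crux_iff_core`: Crux ↔ [(H1)+(H2)+(H3)+(H4)+(H7) ⇒ rotation invariance], no `Δ` at all;
  CONTINUITY IS FREE: `limit_continuousOn` — every `S n` of ANY limit of `criticalCorr 3` is continuous
  on `NonCoincident` (cellmate-shift pigeonhole + free translations);
  (H4) is NOT load-bearing either (`crux_iff_withoutNondegeneracy`: a degenerate instance has
  `S₂ ≡ 0` by transport of one zero, then `0 ≤ S₄ ≤ ΣS₂S₂ = 0` by Griffiths I + Lebowitz in the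
  limit, `U₄ ≡ 0`, and the dichotomy makes it trivial `(1,0,0,…)`, which is rotation invariant)
  ⇒ `crux_iff_bare`: Crux ↔ [(H1)+(H2)+(H3)+(∃Δ scale)+(H7) ⇒ rotation invariance];
  `crux_of_inversionUpgrade`: an inversion-first upgrade (inversion covariance of every instance,
  WITHOUT presupposing rotations) implies the crux (tree `isRotationInvariant_of_inversion`);
  **the GAUSSIAN alternative is TRUE**: `isRotationInvariant_of_gaussian` (U₄ ≡ 0 on NonCoincident ⇒
  all `S_{2m}` are Wick sums of the round `S₂`, tree Aizenman–Newman dichotomy) and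
  `rotationInvariant_or_nontrivialU4` — the open content of the crux lives in the non-Gaussian
  alternative the route needs anyway (crux (E)).
* §2 PINNED DATA — `limit_unique` (`S` is determined by `ρ`: ONE candidate counterexample per `ρ`,
  the Ising₃ limit itself), `limit_zero_eq_one`, `delta_mem_Icc` (`Δ ∈ [1/2,1]`), `two_point_law`
  (`S₂(a,b) = ‖a-b‖^{-2Δ} S₂(0,e₀)`), `rotIdentityAt_four_iff` (order 4 of the crux IS the `O(3)`
  invariance of `U₄`; the Wick part is already round).
* §3 LOAD-BEARING ANALYSIS — the CUBIC DECOY `cubicFamily Δ` (`S₂ = ‖a-b‖^{-2Δ}` exactly round,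
  `S₄ = Wick − bump·aniso`, `aniso = Σ((xᵢ-xⱼ)ₖ)⁴/(Σ‖xᵢ-xⱼ‖²)²`): translation invariant, scale
  covariant, normalised, non-degenerate, H7, `B₃`-invariant, permutation symmetric, `≥ 0`, Lebowitz
  `U₄ ≤ 0`, `|U₄| ≤ S₂²`, continuous off diagonals, clustering (`U₄ → 0` as a pair recedes,
  `cubicFamily_cluster`), and the scaling limit of its own sampling on `ℤ³`
  (`cubicFamily_hasPointwiseScalingLimit`) — yet NOT rotation invariant
  (`cubicFamily_not_isRotationInvariant`: the collinear quadruple `0,e₀,2e₀,3e₀` versus its image on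
  the rational direction `u = (3/5,4/5,0)`, `Σuₖ⁴ = 337/625 ≠ 1`). Hence
  `not_cruxWithoutIsingLimit` (every `Δ ≠ 0`), `not_cruxWithLatticeLimit`,
  `not_cruxWithCubicLatticeLimit` (`Δ > 0`): (H2) is load-bearing and cannot be weakened to "some
  lattice scaling limit with all generic lattice structure formalised in the tree".
  (H3): `not_cruxWithoutNormalisation` given `CritIsing3DEuclideanLimit` (decorate `S₃` on the
  coincident locus). (H1),(H4): see docstrings — not droppable-and-refutable without the limit.
* §4 NEAR-MISSES / OPEN — `rpCubicDecoy` (the only `sorry`): is there an OS-positive (nine lattice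
  mirrors) decoy in the class of §3? See its docstring: isotropic AVERAGES of anisotropic generalised
  free fields have round `S₂` and cubic `U₄` but lose reflection positivity mirror by mirror;
  derivative composites have `Δ ≥ 5/2`; unknown.
* §5 `-- Targets` (cycle 2): the PICKED line `two-crystals-generate-so3`, skeleton `589b0f0d500a`,
  7 registered stubs — 0 broken: 6 TRUE as typed (`stub_arccosQuarter` PROVED here via Mathlib's
  `niven`; `stub_twistIdentities` checked numerically; `stub_circleClosed` TIGHT:
  `stubCircleClosed_false_without_irrational` / `_without_continuity`), and the bridge
  `stub_hexStackUniversality` RESISTS (= 3D universality `(ℤ³, T)`; no junk in `stCriticalCorr`;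
  contains `m*_T(β_c(T)) = 0`; (H7) is unused by the line even in a general gauge — compact
  stabiliser of `K` — so the line proves the (H7)-free isotropy statement too). §4 sharpened: the
  RP-decoy question reduces to ONE kernel question (Q) on `B₃`-mixtures; two more candidate families
  excluded (finite-harmonic perturbations of every even `ℓ ≥ 2`; anisotropic stable symbols).

## Why it resists (for provers)

1. No junk: `S|NonCoincident` = the limit, `S|coincident = 0`, `S₀ = 1`, odd `= 0`, `Δ ∈ [1/2,1]`,
   `S₂ = r^{-2Δ}·A` round by hypothesis, `B₃` free. What is asked: `SO(3)`-invariance of the connected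
   functions `U₄, U₆, …` of the pinned non-Gaussian limit.
2. Every model-blind surrogate tried is satisfied by `cubicFamily Δ` (15 properties incl. lattice
   provenance and clustering), which is not rotation invariant: a proof must use a property the decoy LACKS. Known
   candidates: OS positivity of ALL orders in the nine lattice mirrors jointly with the pinned `S₂`
   (the route's "NineDirectionOS → ContinuationB3" plan), the random-current representation of `U₄`
   (Aizenman 1982), `criticalCorr`-specific switching/Ward identities, a local stress tensor
   (no lattice theorem). The decoy's `U₄ = -bump·aniso` is smooth, negative, cubic — nothing in GKS /
   Lebowitz / MMS-type sign information distinguishes it from Ising.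
3. A reflection-positive cubic decoy (round `S₂`, cubic `U₄`, OS-positive in the nine mirrors, scale
   covariant with `Δ ∈ [1/2,1]`) would kill every "RP + B₃ + round S₂" line at once; none is known and
   none is excluded (§4) — the sharpest open sub-question on the negative side.
4. (cycle 2) On the picked line the whole difficulty is the bridge (3D universality between `ℤ³` and
   the stacked-triangular lattice `T`), which is at least as strong as the (H7)-free isotropy of the
   Ising₃ limit (§5 (B)); its six companions are theorems (one proved here, two shown tight).
5. Direct numerical falsification would need the critical lattice four-point function's angular
   dependence at separations where corrections to scaling `∝ r^{-2.02}` (rotation restoration,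
   Hasenbusch arXiv:2105.09781; Campostrini et al. cond-mat/9705086) are below the statistical error;
   all published evidence points to restoration, i.e. to the crux being TRUE for Ising. Not a kit job:
   a null result at reachable precision would not discriminate, and a finite lattice cannot exhibit a
   limit object violating the crux.
-/

noncomputable section

namespace Summit.CriticalPhenomena.Ising3DConformalLimit.Cruxes.RotationUpgradeFromTwoPoint.Disproof

open Literature.Probability.LatticeModels Literature.Barriers.CriticalPhenomena
open Literature.MathematicalPhysics.QuantumFieldTheory
open Filter Set Function ScaleNotMoebius
open Summit.CriticalPhenomena.Ising3DConformalLimit.MoebiusLimitExistsNegative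
open scoped Topology

local notation "E³" => EuclideanSpace ℝ (Fin 3)

/-! ## §0 Read-back -/

/-- The crux, by name. [folklore] -/
abbrev Crux : Prop :=
  Summit.CriticalPhenomena.Ising3DConformalLimit.Theses.GaussianScaleMixture.RotationUpgradeFromTwoPoint

/-- (H7) two-point isotropy: the kernel `x ↦ S₂(0,x)` is `O(3)`-invariant off the origin. [folklore] -/
def TwoPointIsotropic (S : CorrFamily 3) : Prop :=
  ∀ (R : E³ ≃ₗᵢ[ℝ] E³) (x : E³), x ≠ 0 → S 2 ![0, R x] = S 2 ![0, x]

/-- The seven hypotheses of the crux on `(ρ, Δ, S)`, bundled: (H1) `ρ > 0` on `(0,1]`,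
(H2) pointwise scaling limit of `criticalCorr 3`, (H3) normalisation off `NonCoincident`,
(H4) non-degenerate two-point function, (H5) translation invariance, (H6) scale covariance with
`Δ`, (H7) two-point isotropy. [folklore] -/
structure Hyp (ρ : ℝ → ℝ) (Δ : ℝ) (S : CorrFamily 3) : Prop where
  rho_pos : ∀ δ ∈ Set.Ioc (0:ℝ) 1, 0 < ρ δ
  lim : HasPointwiseScalingLimit (criticalCorr 3) ρ S
  norm : ∀ n z, z ∉ NonCoincident 3 n → S n z = 0
  nondeg : IsNondegenerateTwoPoint S
  transl : IsTranslationInvariant S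
  scale : IsScaleCovariant Δ S
  iso : TwoPointIsotropic S

/-- Read-back: the crux says `Hyp ρ Δ S → IsRotationInvariant S`. [folklore] -/
theorem crux_iff : Crux ↔ ∀ (ρ : ℝ → ℝ) (Δ : ℝ) (S : CorrFamily 3), Hyp ρ Δ S → IsRotationInvariant S := by
  constructor
  · intro h ρ Δ S hh
    exact h ρ Δ S hh.rho_pos hh.lim hh.norm hh.nondeg hh.transl hh.scale hh.iso
  · intro h ρ Δ S h1 h2 h3 h4 h5 h6 h7
    exact h ρ Δ S ⟨h1, h2, h3, h4, h5, h6, h7⟩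

/-! ## §1 Automatic orders, free symmetries, redundant hypotheses -/

variable {ρ : ℝ → ℝ} {Δ : ℝ} {S : CorrFamily 3}

/-- The rotation identity of order `n` (one clause of `IsRotationInvariant`). [folklore] -/
def RotIdentityAt (S : CorrFamily 3) (n : ℕ) : Prop :=
  ∀ (R : E³ ≃ₗᵢ[ℝ] E³) (x : Fin n → E³), S n (fun i => R (x i)) = S n x

/-- `IsRotationInvariant` is the conjunction of the order-`n` identities. [folklore] -/
theorem isRotationInvariant_iff_forall (S : CorrFamily 3) :
    IsRotationInvariant S ↔ ∀ n, RotIdentityAt S n := Iff.rfl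

/-- `n = 0`: automatic for every family. [folklore] -/
theorem rotIdentityAt_zero (S : CorrFamily 3) : RotIdentityAt S 0 := by
  intro R x
  have hx : (fun i => R (x i)) = x := funext fun i => i.elim0
  rw [hx]

/-- If `S n` vanishes identically, the order-`n` identity holds. [folklore] -/
theorem rotIdentityAt_of_eq_zero {S : CorrFamily 3} {n : ℕ} (h : ∀ x, S n x = 0) :
    RotIdentityAt S n := by
  intro R x
  rw [h, h]

/-- ODD ORDERS vanish for limits of `criticalCorr 3`: `S n ≡ 0` (on `NonCoincident` by
`m*(β_c) = 0`, tree theorem `HasPointwiseScalingLimit.eq_zero_of_odd`; off it by (H3)).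
[cite: AizenmanDuminilCopinSidoraviciusCMP2015, Thm. 1.2] -/
theorem limit_odd_eq_zero (hlim : HasPointwiseScalingLimit (criticalCorr 3) ρ S)
    (hnorm : ∀ n z, z ∉ NonCoincident 3 n → S n z = 0) {n : ℕ} (hn : Odd n)
    (x : Fin n → E³) : S n x = 0 := by
  by_cases hx : x ∈ NonCoincident 3 n
  · exact hlim.eq_zero_of_odd (by norm_num) hn hx
  · exact hnorm n x hx

/-- ODD ORDERS of the conclusion are automatic under (H2) + (H3). [folklore] -/
theorem rotIdentityAt_odd (h : Hyp ρ Δ S) {n : ℕ} (hn : Odd n) : RotIdentityAt S n :=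
  rotIdentityAt_of_eq_zero (limit_odd_eq_zero h.lim h.norm hn)

/-- Translation invariance at order two: `S₂(a,b) = S₂(0, b - a)` (all `a, b`). [folklore] -/
theorem two_point_transl (htr : IsTranslationInvariant S) (a b : E³) :
    S 2 ![a, b] = S 2 ![0, b - a] := by
  have h := htr 2 (-a) ![a, b]
  rw [← h]
  congr 1
  funext i
  fin_cases i <;> simp [sub_eq_add_neg]

/-- (H5) + (H7) give FULL `O(3)` invariance of `S₂`, at every pair of points (coincident pairs
included: both sides are `S₂(0,0)`). MODEL-BLIND. [folklore] -/
theorem two_point_rot (htr : IsTranslationInvariant S) (hiso : TwoPointIsotropic S)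
    (R : E³ ≃ₗᵢ[ℝ] E³) (a b : E³) : S 2 ![R a, R b] = S 2 ![a, b] := by
  rw [two_point_transl htr (R a) (R b), two_point_transl htr a b, ← map_sub]
  by_cases hab : b - a = 0
  · rw [hab, map_zero]
  · exact hiso R (b - a) hab

/-- The two-point function is symmetric under (H5) + (H7) (use `R = -1`). [folklore] -/
theorem two_point_symm (htr : IsTranslationInvariant S) (hiso : TwoPointIsotropic S)
    (p q : E³) : S 2 ![p, q] = S 2 ![q, p] := by
  rw [two_point_transl htr p q, two_point_transl htr q p]
  by_cases h : q - p = 0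
  · have h' : p - q = 0 := by rw [← neg_sub, h, neg_zero]
    rw [h, h']
  · have := hiso (LinearIsometryEquiv.neg ℝ) (q - p) h
    simp only [LinearIsometryEquiv.coe_neg] at this
    rw [← this]
    congr 2
    abel

/-- `n = 2` of the conclusion is automatic and MODEL-BLIND: it needs only (H5) translation
invariance and (H7) two-point isotropy. [folklore] -/
theorem rotIdentityAt_two (htr : IsTranslationInvariant S) (hiso : TwoPointIsotropic S) :
    RotIdentityAt S 2 := by
  intro R x
  have hx : x = ![x 0, x 1] := by funext i; fin_cases i <;> rfl
  have hRx : (fun i => R (x i)) = ![R (x 0), R (x 1)] := by funext i; fin_cases i <;> rfl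
  rw [hRx]
  conv_rhs => rw [hx]
  exact two_point_rot htr hiso R (x 0) (x 1)

/-- **REDUCTION 1.** The crux is equivalent to its EVEN orders `n ≥ 4`: orders `0`, `2` and all
odd orders of `IsRotationInvariant` are automatic under the hypotheses (`0`: empty configuration;
odd: `m*(β_c) = 0`; `2`: model-blind from (H5)+(H7)). [folklore] -/
theorem crux_iff_evenFromFour :
    Crux ↔ ∀ (ρ : ℝ → ℝ) (Δ : ℝ) (S : CorrFamily 3), Hyp ρ Δ S →
      ∀ n, 4 ≤ n → Even n → RotIdentityAt S n := by
  rw [crux_iff]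
  constructor
  · intro h ρ Δ S hh n _ _
    exact (h ρ Δ S hh) n
  · intro h ρ Δ S hh n
    rcases Nat.even_or_odd n with hev | hodd
    · by_cases h4 : 4 ≤ n
      · exact h ρ Δ S hh n h4 hev
      · interval_cases n
        · exact rotIdentityAt_zero S
        · exact absurd hev (by decide)
        · exact rotIdentityAt_two hh.transl hh.iso
        · exact absurd hev (by decide)
    · exact rotIdentityAt_odd hh hodd

/-! ### Free symmetries of any limit: the hyperoctahedral group `B₃` and `-1` -/

/-- **Coordinate permutations are FREE**: for ANY pointwise limit of `criticalCorr 3` satisfying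
(H3), `S_n(P_π x) = S_n(x)` at every order and every configuration (tree:
`limit_coordPerm`, lattice symmetry of the plus state). [cite: FriedliVelenik2017, Exercise 3.14, p. 115] -/
theorem coordPerm_free (hlim : HasPointwiseScalingLimit (criticalCorr 3) ρ S)
    (hnorm : ∀ n z, z ∉ NonCoincident 3 n → S n z = 0) (π : Equiv.Perm (Fin 3)) (n : ℕ)
    (x : Fin n → E³) :
    S n (fun i => LinearIsometryEquiv.piLpCongrLeft 2 ℝ ℝ π (x i)) = S n x := by
  by_cases hx : x ∈ NonCoincident 3 n
  · exact limit_coordPerm hlim π hx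
  · rw [hnorm n x hx, hnorm n _ (mt (map_mem_nonCoincident_iff _ x).1 hx)]

/-- **Coordinate sign flips are FREE** (tree: `limit_signFlip`). [cite: FriedliVelenik2017, Exercise 3.14, p. 115] -/
theorem signFlip_free (hlim : HasPointwiseScalingLimit (criticalCorr 3) ρ S)
    (hnorm : ∀ n z, z ∉ NonCoincident 3 n → S n z = 0) (ε : Fin 3 → ℤˣ) (R : E³ ≃ₗᵢ[ℝ] E³)
    (hR : ∀ (p : E³) (j : Fin 3), R p j = ((ε j : ℤ) : ℝ) * p j) (n : ℕ) (x : Fin n → E³) :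
    S n (fun i => R (x i)) = S n x := by
  by_cases hx : x ∈ NonCoincident 3 n
  · exact limit_signFlip hlim ε R hR hx
  · rw [hnorm n x hx, hnorm n _ (mt (map_mem_nonCoincident_iff R x).1 hx)]

/-- **The point reflection `-1` is FREE** (tree: `limit_neg`). Since `O(3) = SO(3) × {±1}`, the
crux is a statement about PROPER rotations only. [cite: FriedliVelenik2017, Exercise 3.14, p. 115] -/
theorem neg_free (hlim : HasPointwiseScalingLimit (criticalCorr 3) ρ S)
    (hnorm : ∀ n z, z ∉ NonCoincident 3 n → S n z = 0) (n : ℕ) (x : Fin n → E³) :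
    S n (fun i => -x i) = S n x := by
  by_cases hx : x ∈ NonCoincident 3 n
  · exact limit_neg hlim hx
  · rw [hnorm n x hx, hnorm n _ ?_]
    have := mt (map_mem_nonCoincident_iff (LinearIsometryEquiv.neg ℝ) x).1 hx
    simpa using this

/-- Invariance under `R` and under `-R` are equivalent for a limit (so only `SO(3)` matters).
[folklore] -/
theorem rot_iff_negRot (hlim : HasPointwiseScalingLimit (criticalCorr 3) ρ S)
    (hnorm : ∀ n z, z ∉ NonCoincident 3 n → S n z = 0) (R : E³ ≃ₗᵢ[ℝ] E³) (n : ℕ)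
    (x : Fin n → E³) :
    S n (fun i => R (x i)) = S n x ↔ S n (fun i => -R (x i)) = S n x := by
  rw [neg_free hlim hnorm n (fun i => R (x i))]

/-- `B₃` (hyperoctahedral) invariance of a family, phrased through the generators used in the
tree: coordinate permutations and coordinate sign flips (as linear isometries). [folklore] -/
def IsCubicInvariant (S : CorrFamily 3) : Prop :=
  (∀ (π : Equiv.Perm (Fin 3)) (n : ℕ) (x : Fin n → E³),
      S n (fun i => LinearIsometryEquiv.piLpCongrLeft 2 ℝ ℝ π (x i)) = S n x) ∧
  (∀ (ε : Fin 3 → ℤˣ) (R : E³ ≃ₗᵢ[ℝ] E³), (∀ (p : E³) (j : Fin 3), R p j = ((ε j : ℤ) : ℝ) * p j) →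
      ∀ (n : ℕ) (x : Fin n → E³), S n (fun i => R (x i)) = S n x)

/-- **`B₃` invariance is FREE** under (H2)+(H3). So (H7) only adds "`S₂(0,·)` is `SO(3)`-invariant
modulo `B₃`", and the conclusion only asks for `SO(3)` modulo `B₃` at orders `≥ 4`. [folklore] -/
theorem cubicInvariant_free (hlim : HasPointwiseScalingLimit (criticalCorr 3) ρ S)
    (hnorm : ∀ n z, z ∉ NonCoincident 3 n → S n z = 0) : IsCubicInvariant S :=
  ⟨fun π n x => coordPerm_free hlim hnorm π n x, fun ε R hR n x => signFlip_free hlim hnorm ε R hR n x⟩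

/-! ### Continuity of the limit is FREE (any `ρ`, no other hypothesis)

Locally uniform limits of the lattice step functions need not be continuous in general; for the
critical correlators they are, because the plus state is translation invariant: a common real shift puts
two nearby configurations into the same mesh cells (pigeonhole on each axis), and `S` is translation
invariant on `NonCoincident` (tree `limit_translate`). So the continuity clause of the blocked class
(§3, `CruxWithCubicLatticeLimit`) is met by EVERY instance of the crux, and lines needing a continuous
limit (e.g. "`B₃` + one more finite-order rotation + continuity ⇒ `SO(3)`") get it for free. -/

/-! #### The pigeonhole on one axis -/

/-- Core of the pigeonhole: if `lo ≤ hi < lo + L` and two shifts `s, s'` with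
`L ≤ s' - s ≤ 1 - L` BOTH put a cell wall between `lo` and `hi`, the two walls are integers at
distance in `(0, 1)` — impossible. [folklore] -/
theorem floor_walls_aux {lo hi s s' L : ℝ} (hlohi : lo ≤ hi) (hL : hi - lo < L) (h1 : L ≤ s' - s)
    (h2 : s' - s ≤ 1 - L) (hs : ⌊lo + s⌋ ≠ ⌊hi + s⌋) (hs' : ⌊lo + s'⌋ ≠ ⌊hi + s'⌋) : False := by
  have hk : ⌊lo + s⌋ < ⌊hi + s⌋ := lt_of_le_of_ne (Int.floor_mono (by linarith)) hs
  have hk' : ⌊lo + s'⌋ < ⌊hi + s'⌋ := lt_of_le_of_ne (Int.floor_mono (by linarith)) hs'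
  -- `lo + s < ⌊hi + s⌋ ≤ hi + s` and `lo + s' < ⌊hi + s'⌋ ≤ hi + s'`
  have hk1 : lo + s < ((⌊hi + s⌋ : ℤ) : ℝ) := by
    have h := Int.lt_floor_add_one (lo + s)
    have h' : ((⌊lo + s⌋ + 1 : ℤ) : ℝ) ≤ ((⌊hi + s⌋ : ℤ) : ℝ) := by exact_mod_cast hk
    push_cast at h'
    linarith
  have hk2 : ((⌊hi + s⌋ : ℤ) : ℝ) ≤ hi + s := Int.floor_le _
  have hk1' : lo + s' < ((⌊hi + s'⌋ : ℤ) : ℝ) := by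
    have h := Int.lt_floor_add_one (lo + s')
    have h' : ((⌊lo + s'⌋ + 1 : ℤ) : ℝ) ≤ ((⌊hi + s'⌋ : ℤ) : ℝ) := by exact_mod_cast hk'
    push_cast at h'
    linarith
  have hk2' : ((⌊hi + s'⌋ : ℤ) : ℝ) ≤ hi + s' := Int.floor_le _
  have h3 : (0 : ℤ) < ⌊hi + s'⌋ - ⌊hi + s⌋ := by
    have : (0 : ℝ) < ((⌊hi + s'⌋ : ℤ) : ℝ) - ((⌊hi + s⌋ : ℤ) : ℝ) := by linarith
    exact_mod_cast this
  have h4 : ⌊hi + s'⌋ - ⌊hi + s⌋ < (1 : ℤ) := by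
    have : ((⌊hi + s'⌋ : ℤ) : ℝ) - ((⌊hi + s⌋ : ℤ) : ℝ) < 1 := by linarith
    exact_mod_cast this
  omega

/-- Symmetric form of `floor_walls_aux`. [folklore] -/
theorem floor_walls {a b s s' L : ℝ} (hL : |a - b| < L) (h1 : L ≤ s' - s) (h2 : s' - s ≤ 1 - L)
    (hs : ⌊a + s⌋ ≠ ⌊b + s⌋) (hs' : ⌊a + s'⌋ ≠ ⌊b + s'⌋) : False := by
  rcases le_total a b with hab | hab
  · have : b - a < L := by
      rw [abs_sub_comm] at hL
      exact lt_of_le_of_lt (le_abs_self _) hL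
    exact floor_walls_aux hab this h1 h2 hs hs'
  · have : a - b < L := lt_of_le_of_lt (le_abs_self _) hL
    exact floor_walls_aux hab this h1 h2 (Ne.symm hs) (Ne.symm hs')

/-- **One-axis pigeonhole.** For `n` pairs of reals within `1/(n+1)` of each other there is a common
shift `s ∈ [0, 1)` after which each pair lies in the same unit cell. [folklore] -/
theorem exists_shift_floor_eq {n : ℕ} (a b : Fin n → ℝ) (hab : ∀ i, |a i - b i| < 1 / (n + 1)) :
    ∃ s : ℝ, 0 ≤ s ∧ s < 1 ∧ ∀ i, ⌊a i + s⌋ = ⌊b i + s⌋ := by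
  by_contra hcon
  push Not at hcon
  have hn1 : (0 : ℝ) < n + 1 := by positivity
  -- every candidate `m/(n+1)` has a bad index
  have hbad : ∀ m : Fin (n + 1), ∃ i, ⌊a i + (m : ℝ) / (n + 1)⌋ ≠ ⌊b i + (m : ℝ) / (n + 1)⌋ := by
    intro m
    refine hcon _ (by positivity) ?_
    rw [div_lt_one hn1]
    exact_mod_cast m.is_lt
  choose f hf using hbad
  obtain ⟨m, m', hne, hfe⟩ := Fintype.exists_ne_map_eq_of_card_lt f (by simp)
  -- two candidates with the same bad index contradict `floor_walls`
  have key : ∀ m m' : Fin (n + 1), m < m' → f m = f m' → False := by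
    intro m m' hlt hfeq
    have hmm' : (m : ℝ) + 1 ≤ m' := by exact_mod_cast (Nat.succ_le_of_lt hlt)
    have hm'n : (m' : ℝ) ≤ n := by exact_mod_cast (Nat.le_of_lt_succ m'.is_lt)
    have hm0 : (0 : ℝ) ≤ m := by positivity
    have hfm' := hf m'
    rw [← hfeq] at hfm'
    refine floor_walls (L := 1 / (n + 1)) (s := (m : ℝ) / (n + 1)) (s' := (m' : ℝ) / (n + 1))
      (hab (f m)) ?_ ?_ (hf m) hfm'
    · rw [div_sub_div_same, div_le_div_iff_of_pos_right hn1]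
      linarith
    · rw [div_sub_div_same, one_sub_div hn1.ne', div_le_div_iff_of_pos_right hn1]
      linarith
  rcases lt_or_gt_of_ne hne with hlt | hlt
  · exact key m m' hlt hfe
  · exact key m' m hlt hfe.symm

/-! #### The common cellmate shift in `ℝ³` -/

/-- A coordinate is bounded by the Euclidean norm. [folklore] -/
theorem abs_apply_le_norm (v : E³) (j : Fin 3) : |v j| ≤ ‖v‖ := by
  rw [EuclideanSpace.norm_eq]
  have h : |v j| = Real.sqrt (‖v j‖ ^ 2) := by
    rw [Real.norm_eq_abs, Real.sqrt_sq (abs_nonneg _)]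
  rw [h]
  exact Real.sqrt_le_sqrt
    (Finset.single_le_sum (f := fun k => ‖v k‖ ^ 2) (fun _ _ => sq_nonneg _) (Finset.mem_univ j))

/-- **Cellmate shift.** If two configurations of `n` points in `ℝ³` have all coordinates within
`δ/(n+1)`, a common shift `w` (`‖w‖ ≤ 2δ`) puts `x + w` and `y + w` in the same mesh-`δ` cells:
`⌊(xᵢ + w)ⱼ/δ⌋ = ⌊(yᵢ + w)ⱼ/δ⌋` for all `i, j`. [folklore] -/
theorem exists_cellmate_shift {n : ℕ} {δ : ℝ} (hδ : 0 < δ) (x y : Fin n → E³)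
    (hxy : ∀ i j, |x i j - y i j| < δ / (n + 1)) :
    ∃ w : E³, ‖w‖ ≤ 2 * δ ∧ ∀ i j, ⌊(x i + w) j / δ⌋ = ⌊(y i + w) j / δ⌋ := by
  have hn1 : (0 : ℝ) < n + 1 := by positivity
  have h : ∀ j : Fin 3, ∃ s : ℝ, 0 ≤ s ∧ s < 1 ∧ ∀ i, ⌊x i j / δ + s⌋ = ⌊y i j / δ + s⌋ := by
    intro j
    refine exists_shift_floor_eq (fun i => x i j / δ) (fun i => y i j / δ) fun i => ?_
    have h1 : |x i j / δ - y i j / δ| = |x i j - y i j| / δ := by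
      rw [← sub_div, abs_div, abs_of_pos hδ]
    rw [h1, div_lt_iff₀ hδ]
    calc |x i j - y i j| < δ / (n + 1) := hxy i j
      _ = 1 / (n + 1) * δ := by ring
  choose s hs0 hs1 hs using h
  set w : E³ := WithLp.toLp 2 (fun j => δ * s j) with hw
  have hwj : ∀ j, w j = δ * s j := fun j => rfl
  refine ⟨w, ?_, fun i j => ?_⟩
  · rw [EuclideanSpace.norm_eq]
    have hle : ∑ k : Fin 3, ‖w k‖ ^ 2 ≤ (2 * δ) ^ 2 := by
      have hk : ∀ k : Fin 3, ‖w k‖ ^ 2 ≤ δ ^ 2 := by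
        intro k
        rw [hwj, Real.norm_eq_abs, sq_abs]
        have h0 := hs0 k
        have h1 := hs1 k
        have hs2 : s k ^ 2 ≤ 1 := by nlinarith
        calc (δ * s k) ^ 2 = δ ^ 2 * s k ^ 2 := by ring
          _ ≤ δ ^ 2 * 1 := mul_le_mul_of_nonneg_left hs2 (sq_nonneg _)
          _ = δ ^ 2 := mul_one _
      calc ∑ k : Fin 3, ‖w k‖ ^ 2 ≤ ∑ _k : Fin 3, δ ^ 2 := Finset.sum_le_sum fun k _ => hk k
        _ = 3 * δ ^ 2 := by simp
        _ ≤ (2 * δ) ^ 2 := by nlinarith [hδ]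
    calc Real.sqrt (∑ k : Fin 3, ‖w k‖ ^ 2) ≤ Real.sqrt ((2 * δ) ^ 2) := Real.sqrt_le_sqrt hle
      _ = 2 * δ := Real.sqrt_sq (by linarith)
  · have hx : (x i + w) j / δ = x i j / δ + s j := by
      have : (x i + w) j = x i j + δ * s j := by rw [← hwj]; rfl
      rw [this, add_div, mul_div_cancel_left₀ _ hδ.ne']
    have hy : (y i + w) j / δ = y i j / δ + s j := by
      have : (y i + w) j = y i j + δ * s j := by rw [← hwj]; rfl
      rw [this, add_div, mul_div_cancel_left₀ _ hδ.ne']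
    rw [hx, hy]
    exact hs j i

/-- Cellmates have the same rescaled correlator (any lattice family). [folklore] -/
theorem rescaledCorrelator_eq_of_cellmates (G : LatticeCorrFamily 3) (ρ : ℝ → ℝ) {n : ℕ} (δ : ℝ)
    {x y : Fin n → E³} (h : ∀ i j, ⌊x i j / δ⌋ = ⌊y i j / δ⌋) :
    rescaledCorrelator G ρ n δ x = rescaledCorrelator G ρ n δ y := by
  rw [rescaledCorrelator_apply, rescaledCorrelator_apply]
  congr 2
  funext i
  funext j
  rw [latticeApprox_apply, latticeApprox_apply, h i j]

/-! #### Continuity of every limit -/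

/-- **Continuity is FREE**: for ANY pointwise scaling limit `S` of the critical correlators on `ℤ³`
(any `ρ`), every `S n` is continuous on `NonCoincident 3 n`. [cite: FriedliVelenik2017, Thm. 3.17] -/
theorem limit_continuousOn (hlim : HasPointwiseScalingLimit (criticalCorr 3) ρ S) (n : ℕ) :
    ContinuousOn (S n) (NonCoincident 3 n) := by
  intro x₀ hx₀
  rw [Metric.continuousWithinAt_iff]
  intro ε hε
  have hε3 : 0 < ε / 3 := by positivity
  have hU := hlim n
  rw [Metric.tendstoLocallyUniformlyOn_iff] at hU
  obtain ⟨t, ht, hev⟩ := hU (ε / 3) hε3 x₀ hx₀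
  obtain ⟨r, hr, hsub⟩ := Metric.mem_nhdsWithin_iff.1 ht
  -- a mesh `δ < r/4` at which the uniform estimate holds on `t`
  have hr4 : (0 : ℝ) < r / 4 := by positivity
  obtain ⟨δ, hPδ, hδmem⟩ := (hev.and (Ioo_mem_nhdsGT hr4)).exists
  have hδ : 0 < δ := hδmem.1
  have hδr : δ < r / 4 := hδmem.2
  have hn1 : (0 : ℝ) < n + 1 := by positivity
  refine ⟨δ / (n + 1), by positivity, fun {y} hy hdist => ?_⟩
  -- coordinates of `y` and `x₀` are within `δ/(n+1)`
  have hcoord : ∀ i j, |x₀ i j - y i j| < δ / (n + 1) := by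
    intro i j
    have hi : dist (y i) (x₀ i) < δ / (n + 1) := (dist_pi_lt_iff (by positivity)).1 hdist i
    rw [dist_eq_norm] at hi
    calc |x₀ i j - y i j| = |(y i - x₀ i) j| := by
            rw [abs_sub_comm]; rfl
      _ ≤ ‖y i - x₀ i‖ := abs_apply_le_norm _ _
      _ < δ / (n + 1) := hi
  obtain ⟨w, hwnorm, hcell⟩ := exists_cellmate_shift hδ x₀ y hcoord
  -- the shifted configurations lie in `ball x₀ r ∩ NonCoincident`, hence in `t`
  have hδn : δ / (n + 1) ≤ δ := div_le_self hδ.le (by linarith)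
  have hx' : (fun i => x₀ i + w) ∈ t := by
    refine hsub ⟨?_, (add_mem_nonCoincident_iff w x₀).2 hx₀⟩
    rw [Metric.mem_ball]
    rcases Nat.eq_zero_or_pos n with hn | hn
    · subst hn
      have : (fun i : Fin 0 => x₀ i + w) = x₀ := funext fun i => i.elim0
      rw [this, dist_self]; exact hr
    · haveI : Nonempty (Fin n) := ⟨⟨0, hn⟩⟩
      refine (dist_pi_lt_iff hr).2 fun i => ?_
      rw [dist_eq_norm, add_sub_cancel_left]
      linarith
  have hy' : (fun i => y i + w) ∈ t := by
    refine hsub ⟨?_, (add_mem_nonCoincident_iff w y).2 hy⟩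
    rw [Metric.mem_ball]
    rcases Nat.eq_zero_or_pos n with hn | hn
    · subst hn
      have : (fun i : Fin 0 => y i + w) = x₀ := funext fun i => i.elim0
      rw [this, dist_self]; exact hr
    · haveI : Nonempty (Fin n) := ⟨⟨0, hn⟩⟩
      refine (dist_pi_lt_iff hr).2 fun i => ?_
      have hi : dist (y i) (x₀ i) < δ / (n + 1) := (dist_pi_lt_iff (by positivity)).1 hdist i
      calc dist (y i + w) (x₀ i) ≤ dist (y i + w) (y i) + dist (y i) (x₀ i) := dist_triangle _ _ _
        _ = ‖w‖ + dist (y i) (x₀ i) := by rw [dist_eq_norm, add_sub_cancel_left]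
        _ < r := by linarith
  -- assemble: `S y = S (y+w) ≈ F (y+w) = F (x₀+w) ≈ S (x₀+w) = S x₀`
  have h1 := hPδ _ hx'
  have h2 := hPδ _ hy'
  have hF : rescaledCorrelator (criticalCorr 3) ρ n δ (fun i => x₀ i + w) =
      rescaledCorrelator (criticalCorr 3) ρ n δ (fun i => y i + w) :=
    rescaledCorrelator_eq_of_cellmates _ _ δ hcell
  rw [limit_translate hlim w hx₀] at h1
  rw [limit_translate hlim w hy, ← hF] at h2
  rw [dist_comm] at h1
  calc dist (S n y) (S n x₀)
      ≤ dist (S n y) (rescaledCorrelator (criticalCorr 3) ρ n δ fun i => x₀ i + w) +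
          dist (rescaledCorrelator (criticalCorr 3) ρ n δ fun i => x₀ i + w) (S n x₀) :=
        dist_triangle _ _ _
    _ < ε / 3 + ε / 3 := add_lt_add h2 h1
    _ < ε := by linarith

/-- The crux's instances in particular: under (H2) every `S n` is continuous off the diagonals, with
no use of (H1), (H3)–(H7). [folklore] -/
theorem continuousOn_of_limit (hlim : HasPointwiseScalingLimit (criticalCorr 3) ρ S) :
    ∀ n, ContinuousOn (S n) (NonCoincident 3 n) :=
  fun n => limit_continuousOn hlim n

/-! ### Redundant hypotheses: (H5) and (H6) follow from (H1)–(H4) -/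

open Classical in
/-- Under (H3), `S` coincides with its own normalisation. [folklore] -/
theorem normalised_eq (hnorm : ∀ n z, z ∉ NonCoincident 3 n → S n z = 0) :
    (fun n x => if x ∈ NonCoincident 3 n then S n x else 0) = S := by
  funext n x
  split_ifs with hx
  · rfl
  · exact (hnorm n x hx).symm

open Classical in
/-- **(H5) is REDUNDANT**: translation invariance follows from (H2)+(H3) (tree:
`isTranslationInvariant_normalised_of_limit`). [cite: FriedliVelenik2017, Thm. 3.17] -/
theorem translation_redundant (hlim : HasPointwiseScalingLimit (criticalCorr 3) ρ S)
    (hnorm : ∀ n z, z ∉ NonCoincident 3 n → S n z = 0) : IsTranslationInvariant S := by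
  have h := isTranslationInvariant_normalised_of_limit hlim
  rwa [normalised_eq hnorm] at h

open Classical in
/-- **(H6) is REDUNDANT**: scale covariance with SOME `Δ' ∈ [1/2, 1]` follows from
(H1)+(H2)+(H3)+(H4) (tree: `exists_scaleCovariant_normalised`, Karamata on the two-point
function + the `ℤ³` bounds `c|x|⁻² ≤ G ≤ C|x|⁻¹`). [cite: Simon1980, Thm. 1] -/
theorem scale_redundant (hρ : ∀ δ ∈ Set.Ioc (0:ℝ) 1, 0 < ρ δ)
    (hlim : HasPointwiseScalingLimit (criticalCorr 3) ρ S)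
    (hnorm : ∀ n z, z ∉ NonCoincident 3 n → S n z = 0) (hnd : IsNondegenerateTwoPoint S) :
    ∃ Δ' ∈ Set.Icc (1 / 2 : ℝ) 1, IsScaleCovariant Δ' S := by
  obtain ⟨Δ', hΔ', hsc⟩ := exists_scaleCovariant_normalised hρ hlim hnd
  refine ⟨Δ', hΔ', ?_⟩
  rwa [normalised_eq hnorm] at hsc

/-- The `Δ`-free CORE of the crux: (H1)+(H2)+(H3)+(H4)+(H7) ⇒ rotation invariance. [folklore] -/
def CruxCore : Prop :=
  ∀ (ρ : ℝ → ℝ) (S : CorrFamily 3), (∀ δ ∈ Set.Ioc (0:ℝ) 1, 0 < ρ δ) →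
    HasPointwiseScalingLimit (criticalCorr 3) ρ S → (∀ n z, z ∉ NonCoincident 3 n → S n z = 0) →
    IsNondegenerateTwoPoint S → TwoPointIsotropic S → IsRotationInvariant S

/-- **REDUCTION 2.** The crux is equivalent to its `Δ`-free core: the binders `Δ`, (H5) and (H6)
carry no information. [folklore] -/
theorem crux_iff_core : Crux ↔ CruxCore := by
  rw [crux_iff]
  constructor
  · intro h ρ S h1 h2 h3 h4 h7
    obtain ⟨Δ', -, h6⟩ := scale_redundant h1 h2 h3 h4
    exact h ρ Δ' S ⟨h1, h2, h3, h4, translation_redundant h2 h3, h6, h7⟩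
  · intro h ρ Δ S hh
    exact h ρ S hh.rho_pos hh.lim hh.norm hh.nondeg hh.iso

/-! ### The crux follows from an inversion-first upgrade (tree: `isRotationInvariant_of_inversion`) -/

/-- If every instance of the hypotheses is INVERSION covariant (an inversion upgrade that does
not presuppose rotations), the crux follows: translation + scale + inversion covariance with the
same `Δ` + symmetric non-degenerate `S₂` force `O(3)` invariance (tree theorem
`isRotationInvariant_of_inversion`, reflections as words in inversions/translations/dilations).
So an inversion-first line for (D) subsumes (N). [folklore] -/
theorem crux_of_inversionUpgrade
    (hinv : ∀ (ρ : ℝ → ℝ) (Δ : ℝ) (S : CorrFamily 3), Hyp ρ Δ S → IsInversionCovariant Δ S) :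
    Crux := by
  rw [crux_iff]
  intro ρ Δ S hh
  exact isRotationInvariant_of_inversion hh.transl hh.scale (hinv ρ Δ S hh)
    (fun p q _ => two_point_symm hh.transl hh.iso p q) hh.nondeg

/-! ### The Gaussian alternative of the crux is TRUE -/

/-- Wick pairing sums of an `O(3)`-invariant two-point function are `O(3)` invariant. [folklore] -/
theorem pairingSum_rot (htr : IsTranslationInvariant S) (hiso : TwoPointIsotropic S) (m : ℕ)
    (R : E³ ≃ₗᵢ[ℝ] E³) (x : Fin (2 * m) → E³) :
    pairingSum (fun p q => S 2 ![p, q]) m (fun i => R (x i)) =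
      pairingSum (fun p q => S 2 ![p, q]) m x := by
  have hfun : (fun p q => S 2 ![R p, R q]) = fun p q => S 2 ![p, q] := by
    funext p q
    exact two_point_rot htr hiso R p q
  have : pairingSum (fun p q => S 2 ![p, q]) m (fun i => R (x i)) =
      pairingSum (fun p q => S 2 ![R p, R q]) m x := rfl
  rw [this, hfun]

/-- **The crux holds for every GAUSSIAN instance.** If the connected four-point function of the
limit vanishes on non-coincident quadruples, then (Aizenman–Newman dichotomy, tree theorem
`HasPointwiseScalingLimit.eq_pairingSum_of_limitConnectedFour_eq_zero`) every `S_{2m}`, `m ≥ 2`,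
is the Wick pairing sum of `S₂`, hence `O(3)` invariant by (H5)+(H7). So the whole open content of
the crux sits in the NON-Gaussian alternative `U₄ ≢ 0` — the regime the route needs anyway, crux
(E) `IsingEuclidUpgradeR4NonGaussian`. [cite: AizenmanCDM2020, §7, Prop. 7.2] -/
theorem isRotationInvariant_of_gaussian (h : Hyp ρ Δ S)
    (hU : ∀ z ∈ NonCoincident 3 4, limitConnectedFour S z = 0) : IsRotationInvariant S := by
  intro n R x
  rcases Nat.even_or_odd n with hev | hodd
  · by_cases h4 : 4 ≤ n
    · obtain ⟨m, rfl⟩ : ∃ m, n = 2 * m := by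
        obtain ⟨r, hr⟩ := hev
        exact ⟨r, by omega⟩
      have hm2 : 2 ≤ m := by omega
      by_cases hx : x ∈ NonCoincident 3 (2 * m)
      · have hRx := (map_mem_nonCoincident_iff R x).2 hx
        rw [h.lim.eq_pairingSum_of_limitConnectedFour_eq_zero (by norm_num) hU hm2 hRx,
          h.lim.eq_pairingSum_of_limitConnectedFour_eq_zero (by norm_num) hU hm2 hx]
        exact pairingSum_rot h.transl h.iso m R x
      · rw [h.norm _ x hx, h.norm _ _ (mt (map_mem_nonCoincident_iff R x).1 hx)]
    · interval_cases n
      · exact rotIdentityAt_zero S R x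
      · exact absurd hev (by decide)
      · exact rotIdentityAt_two h.transl h.iso R x
      · exact absurd hev (by decide)
  · exact rotIdentityAt_odd h hodd R x

/-- Equivalently: under the hypotheses, EITHER the limit is rotation invariant OR it has a
non-trivial `U₄` (tree dichotomy `hasNontrivialU4_or_wick` made explicit for this crux). [folklore] -/
theorem rotationInvariant_or_nontrivialU4 (h : Hyp ρ Δ S) :
    IsRotationInvariant S ∨ HasNontrivialU4 S := by
  by_cases hU : ∀ z ∈ NonCoincident 3 4, limitConnectedFour S z = 0
  · exact Or.inl (isRotationInvariant_of_gaussian h hU)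
  · refine Or.inr ?_
    by_contra hnt
    exact hU fun z hz => by_contra fun hne => hnt ⟨z, hz, hne⟩

/-! ### (H4) is NOT load-bearing: degenerate instances are trivial -/

/-- GKS I in infinite volume: `0 ≤ ⟨∏σ_{yᵢ}⟩⁺_{β_c}` on `ℤ³` (repetitions allowed).
[cite: FriedliVelenik2017, Thm. 3.20, eq. (3.21), p. 109] -/
theorem criticalCorr_nonneg {n : ℕ} (y : Fin n → Site 3) : 0 ≤ criticalCorr 3 n y := by
  classical
  obtain ⟨A, hA⟩ := exists_spinMonomial_eq_spinProduct y
  show 0 ≤ plusExpect 3 (criticalBeta 3) 0 (spinMonomial y)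
  rw [hA]
  exact plusCorr_nonneg (criticalBeta_nonneg 3) le_rfl A

/-- **Griffiths I passes to the limit**: under (H1)+(H2), `0 ≤ S n x` on `NonCoincident`. [cite: FriedliVelenik2017, Thm. 3.20] -/
theorem limit_nonneg (hρ : ∀ δ ∈ Set.Ioc (0:ℝ) 1, 0 < ρ δ)
    (hlim : HasPointwiseScalingLimit (criticalCorr 3) ρ S) {n : ℕ} {x : Fin n → E³}
    (hx : x ∈ NonCoincident 3 n) : 0 ≤ S n x := by
  refine ge_of_tendsto ((hlim n).tendsto_at hx) ?_
  have hmem : Set.Ioc (0:ℝ) 1 ∈ 𝓝[>] (0:ℝ) := Ioc_mem_nhdsGT one_pos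
  filter_upwards [hmem] with δ hδ
  rw [rescaledCorrelator_apply]
  exact mul_nonneg (pow_nonneg (hρ δ hδ).le n) (criticalCorr_nonneg _)

/-- Transport of a zero of the two-point kernel under (H6)+(H7): `S₂(0,v) = 0` for ONE `v ≠ 0`
forces `S₂(0,w) = 0` for EVERY `w ≠ 0` (dilate, then reflect with `Submodule.reflection_sub`).
MODEL-BLIND. [folklore] -/
theorem two_kernel_eq_zero_of_zero (hsc : IsScaleCovariant Δ S) (hiso : TwoPointIsotropic S)
    {v : E³} (hv : v ≠ 0) (h0 : S 2 ![0, v] = 0) {w : E³} (hw : w ≠ 0) : S 2 ![0, w] = 0 := by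
  have hvn : 0 < ‖v‖ := norm_pos_iff.mpr hv
  have hwn : 0 < ‖w‖ := norm_pos_iff.mpr hw
  set c : ℝ := ‖w‖ / ‖v‖ with hc
  have hc0 : 0 < c := div_pos hwn hvn
  have h1 : S 2 ![0, c • v] = 0 := by
    have h := hsc 2 c hc0 ![0, v]
    have hfun : (fun i => c • (![0, v] : Fin 2 → E³) i) = ![0, c • v] := by
      funext i
      fin_cases i <;> simp
    rw [hfun, h0, mul_zero] at h
    exact h
  have hnorm : ‖c • v‖ = ‖w‖ := by
    rw [norm_smul, Real.norm_eq_abs, abs_of_pos hc0, hc, div_mul_cancel₀ _ hvn.ne']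
  have hcv : c • v ≠ 0 := smul_ne_zero hc0.ne' hv
  have hR : Submodule.reflection (ℝ ∙ (c • v - w))ᗮ (c • v) = w := Submodule.reflection_sub hnorm
  rw [← hR, hiso _ (c • v) hcv, h1]

/-- A DEGENERATE instance of (H1)–(H3)+(H5)–(H7) has `S₂ ≡ 0`. [folklore] -/
theorem two_eq_zero_of_degenerate (hρ : ∀ δ ∈ Set.Ioc (0:ℝ) 1, 0 < ρ δ)
    (hlim : HasPointwiseScalingLimit (criticalCorr 3) ρ S)
    (hnorm : ∀ n z, z ∉ NonCoincident 3 n → S n z = 0) (htr : IsTranslationInvariant S)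
    (hsc : IsScaleCovariant Δ S) (hiso : TwoPointIsotropic S) (hdeg : ¬ IsNondegenerateTwoPoint S)
    (y : Fin 2 → E³) : S 2 y = 0 := by
  obtain ⟨z, hz, hle⟩ : ∃ z ∈ NonCoincident 3 2, S 2 z ≤ 0 := by
    by_contra h
    push Not at h
    exact hdeg fun z hz => h z hz
  have hz0 : S 2 z = 0 := le_antisymm hle (limit_nonneg hρ hlim hz)
  have hzinj : z 0 ≠ z 1 := (injective_fin_two_iff z).1 ((mem_nonCoincident z).1 hz)
  have hzcfg : z = ![z 0, z 1] := by funext i; fin_cases i <;> rfl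
  have hv : z 1 - z 0 ≠ 0 := sub_ne_zero.mpr hzinj.symm
  have hker : S 2 ![0, z 1 - z 0] = 0 := by
    rw [← two_point_transl htr (z 0) (z 1), ← hzcfg, hz0]
  by_cases hy : y ∈ NonCoincident 3 2
  · have hyinj : y 0 ≠ y 1 := (injective_fin_two_iff y).1 ((mem_nonCoincident y).1 hy)
    have hycfg : y = ![y 0, y 1] := by funext i; fin_cases i <;> rfl
    rw [hycfg, two_point_transl htr (y 0) (y 1)]
    exact two_kernel_eq_zero_of_zero hsc hiso hv hker (sub_ne_zero.mpr hyinj.symm)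
  · exact hnorm 2 y hy

/-- A Wick pairing sum of the zero kernel vanishes (`m ≥ 1`). [folklore] -/
theorem pairingSum_zero_kernel {m : ℕ} (hm : 1 ≤ m) (x : Fin (2 * m) → E³) :
    pairingSum (fun _ _ : E³ => (0:ℝ)) m x = 0 := by
  unfold pairingSum
  have hne : (Finset.univ : Finset (Fin m)).Nonempty := ⟨⟨0, hm⟩, Finset.mem_univ _⟩
  obtain ⟨j, hj⟩ := hne
  simp [Finset.prod_eq_zero hj]

/-- **A degenerate instance is trivial, hence rotation invariant**: `S₂ ≡ 0`; `0 ≤ S₄ ≤ Σ S₂S₂ = 0`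
on non-coincident quadruples (Griffiths I in the limit and the limit form of Lebowitz, tree
`limitConnectedFour_nonpos_of_hasPointwiseScalingLimit`); hence `U₄ ≡ 0` and the Aizenman–Newman
dichotomy kills every even order `≥ 4`; odd orders vanish. [cite: AizenmanCDM2020, §7, Prop. 7.2] -/
theorem isRotationInvariant_of_degenerate (hρ : ∀ δ ∈ Set.Ioc (0:ℝ) 1, 0 < ρ δ)
    (hlim : HasPointwiseScalingLimit (criticalCorr 3) ρ S)
    (hnorm : ∀ n z, z ∉ NonCoincident 3 n → S n z = 0) (htr : IsTranslationInvariant S)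
    (hsc : IsScaleCovariant Δ S) (hiso : TwoPointIsotropic S) (hdeg : ¬ IsNondegenerateTwoPoint S) :
    IsRotationInvariant S := by
  have h2 : ∀ y, S 2 y = 0 := two_eq_zero_of_degenerate hρ hlim hnorm htr hsc hiso hdeg
  have hU : ∀ z ∈ NonCoincident 3 4, limitConnectedFour S z = 0 := by
    intro z hz
    have hle := limitConnectedFour_nonpos_of_hasPointwiseScalingLimit (by norm_num) hlim hz
    have hge : 0 ≤ S 4 z := limit_nonneg hρ hlim hz
    simp only [limitConnectedFour, h2, mul_zero, add_zero, sub_zero] at hle ⊢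
    exact le_antisymm hle hge
  have hvan : ∀ n, 1 ≤ n → ∀ x, S n x = 0 := by
    intro n hn x
    rcases Nat.even_or_odd n with hev | hodd
    · obtain ⟨m, rfl⟩ : ∃ m, n = 2 * m := by
        obtain ⟨r, hr⟩ := hev
        exact ⟨r, by omega⟩
      rcases Nat.lt_or_ge m 2 with hm | hm
      · interval_cases m
        · omega
        · exact h2 x
      · by_cases hx : x ∈ NonCoincident 3 (2 * m)
        · rw [hlim.eq_pairingSum_of_limitConnectedFour_eq_zero (by norm_num) hU hm hx]
          have hk : (fun p q : E³ => S 2 ![p, q]) = fun _ _ => (0:ℝ) := by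
            funext p q; exact h2 _
          rw [hk]
          exact pairingSum_zero_kernel (by omega) x
        · exact hnorm _ x hx
    · exact limit_odd_eq_zero hlim hnorm hodd x
  intro n R x
  rcases Nat.eq_zero_or_pos n with rfl | hn
  · exact rotIdentityAt_zero S R x
  · rw [hvan n hn, hvan n hn]

/-- The crux with (H4) deleted. [folklore] -/
def CruxWithoutNondegeneracy : Prop :=
  ∀ (ρ : ℝ → ℝ) (Δ : ℝ) (S : CorrFamily 3), (∀ δ ∈ Set.Ioc (0:ℝ) 1, 0 < ρ δ) →
    HasPointwiseScalingLimit (criticalCorr 3) ρ S → (∀ n z, z ∉ NonCoincident 3 n → S n z = 0) →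
    IsTranslationInvariant S → IsScaleCovariant Δ S → TwoPointIsotropic S → IsRotationInvariant S

/-- **REDUCTION 3: (H4) is NOT load-bearing** — the crux is equivalent to its version without
non-degeneracy (degenerate instances are trivial and rotation invariant); (H4) only removes the junk
renormalisations, none of which endangers the conclusion. [folklore] -/
theorem crux_iff_withoutNondegeneracy : Crux ↔ CruxWithoutNondegeneracy := by
  rw [crux_iff]
  constructor
  · intro h ρ Δ S h1 h2 h3 h5 h6 h7
    by_cases h4 : IsNondegenerateTwoPoint S
    · exact h ρ Δ S ⟨h1, h2, h3, h4, h5, h6, h7⟩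
    · exact isRotationInvariant_of_degenerate h1 h2 h3 h5 h6 h7 h4
  · intro h ρ Δ S hh
    exact h ρ Δ S hh.rho_pos hh.lim hh.norm hh.transl hh.scale hh.iso

/-- **The BARE CORE.** Crux ⇔ "(H1)+(H2)+(H3)+(H7) and scale covariance with SOME exponent ⇒
rotation invariance": no `Δ`-binder content, no (H4), no (H5). [folklore] -/
theorem crux_iff_bare :
    Crux ↔ ∀ (ρ : ℝ → ℝ) (S : CorrFamily 3), (∀ δ ∈ Set.Ioc (0:ℝ) 1, 0 < ρ δ) →
      HasPointwiseScalingLimit (criticalCorr 3) ρ S → (∀ n z, z ∉ NonCoincident 3 n → S n z = 0) →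
      (∃ Δ : ℝ, IsScaleCovariant Δ S) → TwoPointIsotropic S → IsRotationInvariant S := by
  rw [crux_iff_withoutNondegeneracy]
  constructor
  · intro h ρ S h1 h2 h3 ⟨Δ, h6⟩ h7
    exact h ρ Δ S h1 h2 h3 (translation_redundant h2 h3) h6 h7
  · intro h ρ Δ S h1 h2 h3 _ h6 h7
    exact h ρ S h1 h2 h3 ⟨Δ, h6⟩ h7

/-! ## §2 Pinned data: `S₀ = 1`, `Δ ∈ [1/2,1]`, the two-point law, the four-point split -/

/-- `⟨1⟩⁺_{β_c} = 1`: the empty spin monomial. [folklore] -/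
theorem criticalCorr_fin_zero (x : Fin 0 → Site 3) : criticalCorr 3 0 x = 1 := by
  have hx : spinMonomial x = fun _ => (1:ℝ) := by
    funext s; simp [spinMonomial]
  show plusExpect 3 (criticalBeta 3) 0 (spinMonomial x) = 1
  rw [hx]
  show limUnder atTop
      (fun L : ℕ => isingExpect (zdGraph 3) (box 3 L) (criticalBeta 3) 0 .plus (fun _ => (1:ℝ))) = 1
  simp_rw [isingExpect_const]
  exact tendsto_const_nhds.limUnder_eq

/-- ANY pointwise limit of the critical correlators has `S 0 ≡ 1`. [folklore] -/
theorem limit_zero_eq_one (hlim : HasPointwiseScalingLimit (criticalCorr 3) ρ S)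
    (x : Fin 0 → E³) : S 0 x = 1 := by
  have hx : x ∈ NonCoincident 3 0 := by
    rw [mem_nonCoincident]; intro i; exact Fin.elim0 i
  have h := (hlim 0).tendsto_at hx
  have h1 : Tendsto (fun δ => rescaledCorrelator (criticalCorr 3) ρ 0 δ x) (𝓝[>] (0:ℝ)) (𝓝 1) := by
    refine tendsto_const_nhds.congr fun δ => ?_
    rw [rescaledCorrelator_apply, pow_zero, one_mul, criticalCorr_fin_zero]
  exact tendsto_nhds_unique h h1

/-- **Δ is pinned to the Ising window** `[1/2, 1]` (tree theorem
`scalingDimension_mem_Icc_holds`). [cite: Simon1980, Thm. 1] -/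
theorem delta_mem_Icc (h : Hyp ρ Δ S) : Δ ∈ Set.Icc (1 / 2 : ℝ) 1 :=
  scalingDimension_mem_Icc_holds ρ Δ S h.lim h.scale h.nondeg h.rho_pos

/-- **`S` is PINNED by `ρ`**: two families satisfying (H2) with the same renormalisation and (H3)
are EQUAL (uniqueness of limits on `NonCoincident`, zero elsewhere). So the only freedom in an
instance of the hypotheses is the choice of `ρ` (an overall constant per order, by
`scale_redundant` a power `λⁿ`): there is exactly one candidate counterexample per `ρ`, the Ising₃
limit itself. [folklore] -/
theorem limit_unique {S' : CorrFamily 3} (hlim : HasPointwiseScalingLimit (criticalCorr 3) ρ S)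
    (hlim' : HasPointwiseScalingLimit (criticalCorr 3) ρ S')
    (hnorm : ∀ n z, z ∉ NonCoincident 3 n → S n z = 0)
    (hnorm' : ∀ n z, z ∉ NonCoincident 3 n → S' n z = 0) : S = S' := by
  funext n x
  by_cases hx : x ∈ NonCoincident 3 n
  · exact tendsto_nhds_unique ((hlim n).tendsto_at hx) ((hlim' n).tendsto_at hx)
  · rw [hnorm n x hx, hnorm' n x hx]

/-- **Two-point law.** (H5)+(H6)+(H7) pin `S₂(a,b) = ‖a - b‖^{-2Δ} · S₂(0,e₀)` for `a ≠ b`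
(translate, rotate `b - a` to the axis with `Submodule.reflection_sub`, scale). MODEL-BLIND.
[folklore] -/
theorem two_point_law (htr : IsTranslationInvariant S) (hsc : IsScaleCovariant Δ S)
    (hiso : TwoPointIsotropic S) {a b : E³} (hab : a ≠ b) :
    S 2 ![a, b] = ‖a - b‖ ^ (-(2 * Δ)) * S 2 ![0, axisUnit] := by
  set r : ℝ := ‖b - a‖ with hr
  have hr0 : 0 < r := norm_pos_iff.mpr (sub_ne_zero.mpr (Ne.symm hab))
  have hba : b - a ≠ 0 := sub_ne_zero.mpr (Ne.symm hab)
  have h1 : S 2 ![a, b] = S 2 ![0, b - a] := two_point_transl htr a b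
  have hnorm_eq : ‖b - a‖ = ‖r • axisUnit‖ := by
    rw [norm_smul, norm_axisUnit, mul_one, Real.norm_eq_abs, abs_of_pos hr0]
  have hRv : Submodule.reflection (ℝ ∙ ((b - a) - r • axisUnit))ᗮ (b - a) = r • axisUnit :=
    Submodule.reflection_sub hnorm_eq
  have h2 : S 2 ![0, b - a] = S 2 ![0, r • axisUnit] := by
    rw [← hRv]
    exact (hiso _ (b - a) hba).symm
  have h3 : S 2 ![0, r • axisUnit] = r ^ (-(2 * Δ)) * S 2 ![0, axisUnit] := by
    have h := hsc 2 r hr0 ![0, axisUnit]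
    have hfun : (fun i => r • (![0, axisUnit] : Fin 2 → E³) i) = ![0, r • axisUnit] := by
      funext i
      fin_cases i <;> simp
    have hexp : (-((2 : ℕ) : ℝ) * Δ) = -(2 * Δ) := by push_cast; ring
    rw [hfun, hexp] at h
    exact h
  rw [h1, h2, h3, hr, norm_sub_rev]

/-- **Four-point split.** Under (H5)+(H7) the Wick part of `S₄` is already `O(3)` invariant, so
rotating a quadruple changes `S₄` exactly as it changes the connected function `U₄`. [folklore] -/
theorem limitConnectedFour_rot_sub (htr : IsTranslationInvariant S) (hiso : TwoPointIsotropic S)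
    (R : E³ ≃ₗᵢ[ℝ] E³) (x : Fin 4 → E³) :
    limitConnectedFour S (fun i => R (x i)) - limitConnectedFour S x =
      S 4 (fun i => R (x i)) - S 4 x := by
  simp only [limitConnectedFour, two_point_rot htr hiso]
  ring

/-- Hence the order-4 clause of the crux IS the `O(3)` invariance of `U₄`. [folklore] -/
theorem rotIdentityAt_four_iff (htr : IsTranslationInvariant S) (hiso : TwoPointIsotropic S) :
    RotIdentityAt S 4 ↔
      ∀ (R : E³ ≃ₗᵢ[ℝ] E³) (x : Fin 4 → E³),
        limitConnectedFour S (fun i => R (x i)) = limitConnectedFour S x := by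
  constructor
  · intro h R x
    have := limitConnectedFour_rot_sub htr hiso R x
    rw [h R x, sub_self] at this
    linarith
  · intro h R x
    have := limitConnectedFour_rot_sub htr hiso R x
    rw [h R x, sub_self] at this
    linarith


/-! ## §3 Load-bearing analysis: which hypotheses any proof must use

### The cubic decoy `cubicFamily Δ`

The barrier witness `ScaleNotMoebius.narrowFamily Δ` of `ScaleCovarianceNotMoebius.lean`
(`S₀ = 1`, `S₂ = ‖a - b‖^{-2Δ}`, `S₄ = Wick - bump`, `Sₙ = 0` else) with the bump MODULATED by the
cubic-invariant, `O(3)`-breaking angular factor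
`aniso x = (∑ᵢⱼₖ ((xᵢ - xⱼ)ₖ)⁴) / (∑ᵢⱼ ‖xᵢ - xⱼ‖²)² ∈ [0, 1]`:
`S₄ = Wick - bump · aniso` on non-coincident quadruples. Its two-point function is exactly the
conformal one (isotropic); its connected four-point function `U₄ = -bump·aniso` sees the cubic axes.
-/

/-- The quartic cubic invariant `∑ᵢ ∑ⱼ ∑ₖ ((xᵢ - xⱼ)ₖ)⁴` of a quadruple. [folklore] -/
def quartic (x : Fin 4 → E³) : ℝ := ∑ i, ∑ j, ∑ k, ((x i - x j) k) ^ 4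

/-- The angular modulation `aniso = quartic / sqSum²` (degree `0`, `B₃`-invariant, not
`O(3)`-invariant). [folklore] -/
def aniso (x : Fin 4 → E³) : ℝ := quartic x / sqSum x ^ 2

open Classical in
/-- **The cubic decoy** with parameter `Δ`: `S₀ = 1`, `S₂ = ‖x₀ - x₁‖^{-2Δ}`,
`S₄ = Wick(S₂) - bump · aniso` on non-coincident configurations and `0` on coincident ones,
`Sₙ = 0` otherwise. [folklore] -/
def cubicFamily (Δ : ℝ) : CorrFamily 3 := fun n =>
  match n with
  | 0 => fun _ => 1
  | 2 => fun x => twoPt Δ (x 0) (x 1)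
  | 4 => fun x => if Function.Injective x then wick Δ x - bump Δ x * aniso x else 0
  | _ => fun _ => 0

/-- Unfolding, `n = 0`. [folklore] -/
theorem cubicFamily_zero (Δ : ℝ) (x : Fin 0 → E³) : cubicFamily Δ 0 x = 1 := rfl

/-- Unfolding, `n = 2`. [folklore] -/
theorem cubicFamily_two (Δ : ℝ) (x : Fin 2 → E³) : cubicFamily Δ 2 x = twoPt Δ (x 0) (x 1) := rfl

open Classical in
/-- Unfolding, `n = 4`. [folklore] -/
theorem cubicFamily_four (Δ : ℝ) (x : Fin 4 → E³) :
    cubicFamily Δ 4 x = if Function.Injective x then wick Δ x - bump Δ x * aniso x else 0 := rfl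

/-- Unfolding, `n = 4`, non-coincident configuration. [folklore] -/
theorem cubicFamily_four_of_injective (Δ : ℝ) {x : Fin 4 → E³} (hx : Function.Injective x) :
    cubicFamily Δ 4 x = wick Δ x - bump Δ x * aniso x := by
  rw [cubicFamily_four, if_pos hx]

/-- Unfolding, `n = 4`, coincident configuration. [folklore] -/
theorem cubicFamily_four_of_not_injective (Δ : ℝ) {x : Fin 4 → E³}
    (hx : ¬ Function.Injective x) : cubicFamily Δ 4 x = 0 := by
  rw [cubicFamily_four, if_neg hx]

/-! #### Algebra of `quartic`, `sqSum`, `aniso` -/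

/-- `quartic` is translation invariant. [folklore] -/
theorem quartic_add (x : Fin 4 → E³) (v : E³) : quartic (fun i => x i + v) = quartic x := by
  simp [quartic]

/-- `quartic` is homogeneous of degree `4`. [folklore] -/
theorem quartic_smul (c : ℝ) (x : Fin 4 → E³) : quartic (fun i => c • x i) = c ^ 4 * quartic x := by
  simp only [quartic, ← smul_sub, PiLp.smul_apply, smul_eq_mul, mul_pow, Finset.mul_sum]

/-- `quartic ≥ 0`. [folklore] -/
theorem quartic_nonneg (x : Fin 4 → E³) : 0 ≤ quartic x := by
  unfold quartic
  positivity

/-- `quartic` is symmetric in the four points. [folklore] -/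
theorem quartic_comp_perm (x : Fin 4 → E³) (σ : Equiv.Perm (Fin 4)) :
    quartic (x ∘ σ) = quartic x := by
  unfold quartic
  simp only [Function.comp_apply]
  calc ∑ i, ∑ j, ∑ k, ((x (σ i) - x (σ j)) k) ^ 4 = ∑ i, ∑ j, ∑ k, ((x (σ i) - x j) k) ^ 4 :=
        Finset.sum_congr rfl fun i _ => Equiv.sum_comp σ (fun j => ∑ k, ((x (σ i) - x j) k) ^ 4)
    _ = ∑ i, ∑ j, ∑ k, ((x i - x j) k) ^ 4 := Equiv.sum_comp σ (fun i => ∑ j, ∑ k, ((x i - x j) k) ^ 4)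

/-- `quartic` is invariant under coordinate permutations of `ℝ³`. [folklore] -/
theorem quartic_coordPerm (π : Equiv.Perm (Fin 3)) (x : Fin 4 → E³) :
    quartic (fun i => LinearIsometryEquiv.piLpCongrLeft 2 ℝ ℝ π (x i)) = quartic x := by
  unfold quartic
  refine Finset.sum_congr rfl fun i _ => Finset.sum_congr rfl fun j _ => ?_
  rw [← map_sub]
  simp only [coordPerm_apply]
  exact Equiv.sum_comp π.symm (fun k => ((x i - x j) k) ^ 4)

/-- `quartic` is invariant under coordinate sign flips of `ℝ³`. [folklore] -/
theorem quartic_signFlip (ε : Fin 3 → ℤˣ) (R : E³ ≃ₗᵢ[ℝ] E³)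
    (hR : ∀ (p : E³) (j : Fin 3), R p j = ((ε j : ℤ) : ℝ) * p j) (x : Fin 4 → E³) :
    quartic (fun i => R (x i)) = quartic x := by
  unfold quartic
  refine Finset.sum_congr rfl fun i _ => Finset.sum_congr rfl fun j _ =>
    Finset.sum_congr rfl fun k _ => ?_
  rw [← map_sub, hR, mul_pow]
  have hk : (((ε k : ℤ) : ℝ)) ^ 4 = 1 := by
    rcases Int.units_eq_one_or (ε k) with h | h
    · simp [h]
    · simp [h]; norm_num
  rw [hk, one_mul]

/-- `quartic` restricted to a line: `quartic (tᵢ • w) = (∑ᵢⱼ (tᵢ - tⱼ)⁴) · ∑ₖ wₖ⁴`. [folklore] -/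
theorem quartic_line (t : Fin 4 → ℝ) (w : E³) :
    quartic (fun i => t i • w) = (∑ i, ∑ j, (t i - t j) ^ 4) * ∑ k, (w k) ^ 4 := by
  simp only [quartic, ← sub_smul, PiLp.smul_apply, smul_eq_mul, mul_pow]
  rw [Finset.sum_mul]
  refine Finset.sum_congr rfl fun i _ => ?_
  rw [Finset.sum_mul]
  refine Finset.sum_congr rfl fun j _ => ?_
  rw [Finset.mul_sum]

/-- `sqSum` is translation invariant. [folklore] -/
theorem sqSum_add (x : Fin 4 → E³) (v : E³) : sqSum (fun i => x i + v) = sqSum x := by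
  simp [sqSum]

/-- `sqSum` is `O(3)` invariant. [folklore] -/
theorem sqSum_map (R : E³ ≃ₗᵢ[ℝ] E³) (x : Fin 4 → E³) : sqSum (fun i => R (x i)) = sqSum x := by
  simp only [sqSum, ← map_sub, LinearIsometryEquiv.norm_map]

/-- `wick` is `O(3)` invariant. [folklore] -/
theorem wick_map (Δ : ℝ) (R : E³ ≃ₗᵢ[ℝ] E³) (x : Fin 4 → E³) :
    wick Δ (fun i => R (x i)) = wick Δ x := by
  simp only [wick, twoPt_map]

/-- `bump` is `O(3)` invariant. [folklore] -/
theorem bump_map (Δ : ℝ) (R : E³ ≃ₗᵢ[ℝ] E³) (x : Fin 4 → E³) :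
    bump Δ (fun i => R (x i)) = bump Δ x := by
  rw [bump, bump, sqSum_map]

/-- `wick` is translation invariant. [folklore] -/
theorem wick_add (Δ : ℝ) (x : Fin 4 → E³) (v : E³) : wick Δ (fun i => x i + v) = wick Δ x := by
  simp only [wick, twoPt_add]

/-- `bump` is translation invariant. [folklore] -/
theorem bump_add (Δ : ℝ) (x : Fin 4 → E³) (v : E³) : bump Δ (fun i => x i + v) = bump Δ x := by
  rw [bump, bump, sqSum_add]

/-- `aniso` is translation invariant. [folklore] -/
theorem aniso_add (x : Fin 4 → E³) (v : E³) : aniso (fun i => x i + v) = aniso x := by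
  rw [aniso, aniso, quartic_add, sqSum_add]

/-- `aniso` is dilation invariant. [folklore] -/
theorem aniso_smul {c : ℝ} (hc : 0 < c) (x : Fin 4 → E³) : aniso (fun i => c • x i) = aniso x := by
  rw [aniso, aniso, quartic_smul, sqSum_smul hc, mul_pow, ← pow_mul]
  exact mul_div_mul_left _ _ (pow_ne_zero _ hc.ne')

/-- `aniso` is symmetric in the four points. [folklore] -/
theorem aniso_comp_perm (x : Fin 4 → E³) (σ : Equiv.Perm (Fin 4)) : aniso (x ∘ σ) = aniso x := by
  rw [aniso, aniso, quartic_comp_perm, sqSum_comp_perm]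

/-- `aniso` is invariant under coordinate permutations. [folklore] -/
theorem aniso_coordPerm (π : Equiv.Perm (Fin 3)) (x : Fin 4 → E³) :
    aniso (fun i => LinearIsometryEquiv.piLpCongrLeft 2 ℝ ℝ π (x i)) = aniso x := by
  rw [aniso, aniso, quartic_coordPerm, sqSum_map]

/-- `aniso` is invariant under coordinate sign flips. [folklore] -/
theorem aniso_signFlip (ε : Fin 3 → ℤˣ) (R : E³ ≃ₗᵢ[ℝ] E³)
    (hR : ∀ (p : E³) (j : Fin 3), R p j = ((ε j : ℤ) : ℝ) * p j) (x : Fin 4 → E³) :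
    aniso (fun i => R (x i)) = aniso x := by
  rw [aniso, aniso, quartic_signFlip ε R hR, sqSum_map]

/-- `aniso ≥ 0`. [folklore] -/
theorem aniso_nonneg (x : Fin 4 → E³) : 0 ≤ aniso x :=
  div_nonneg (quartic_nonneg x) (sq_nonneg _)

/-- `∑ₖ vₖ⁴ ≤ ‖v‖⁴` on `ℝ³`. [folklore] -/
theorem sum_pow_four_le (v : E³) : ∑ k, (v k) ^ 4 ≤ (‖v‖ ^ 2) ^ 2 := by
  have hn : ‖v‖ ^ 2 = ∑ k, (v k) ^ 2 := by
    rw [EuclideanSpace.norm_eq, Real.sq_sqrt (Finset.sum_nonneg fun _ _ => sq_nonneg _)]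
    simp [Real.norm_eq_abs, sq_abs]
  rw [hn]
  have key : ∀ k, (v k) ^ 4 ≤ (v k) ^ 2 * ∑ l, (v l) ^ 2 := by
    intro k
    have h1 : (v k) ^ 2 ≤ ∑ l, (v l) ^ 2 :=
      Finset.single_le_sum (f := fun l => (v l) ^ 2) (fun _ _ => sq_nonneg _) (Finset.mem_univ k)
    calc (v k) ^ 4 = (v k) ^ 2 * (v k) ^ 2 := by ring
      _ ≤ (v k) ^ 2 * ∑ l, (v l) ^ 2 := mul_le_mul_of_nonneg_left h1 (sq_nonneg _)
  calc ∑ k, (v k) ^ 4 ≤ ∑ k, (v k) ^ 2 * ∑ l, (v l) ^ 2 := Finset.sum_le_sum fun k _ => key k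
    _ = (∑ k, (v k) ^ 2) ^ 2 := by rw [← Finset.sum_mul]; ring

/-- `quartic ≤ sqSum²`, i.e. `aniso ≤ 1`. [folklore] -/
theorem quartic_le_sqSum_sq (x : Fin 4 → E³) : quartic x ≤ sqSum x ^ 2 := by
  -- termwise `∑ₖ ((xᵢ-xⱼ)ₖ)⁴ ≤ (‖xᵢ-xⱼ‖²)²`, then `∑ aᵢⱼ² ≤ (∑ aᵢⱼ)²` for `aᵢⱼ ≥ 0`
  have h1 : quartic x ≤ ∑ i, ∑ j, (‖x i - x j‖ ^ 2) ^ 2 :=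
    Finset.sum_le_sum fun i _ => Finset.sum_le_sum fun j _ => sum_pow_four_le (x i - x j)
  refine h1.trans ?_
  set a : Fin 4 → Fin 4 → ℝ := fun i j => ‖x i - x j‖ ^ 2 with ha
  have ha0 : ∀ i j, 0 ≤ a i j := fun i j => sq_nonneg _
  have hle : ∀ i j, a i j ≤ sqSum x := fun i j => norm_sub_sq_le_sqSum x i j
  show ∑ i, ∑ j, (a i j) ^ 2 ≤ sqSum x ^ 2
  have hs : sqSum x = ∑ i, ∑ j, a i j := rfl
  calc ∑ i, ∑ j, (a i j) ^ 2 ≤ ∑ i, ∑ j, a i j * sqSum x :=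
        Finset.sum_le_sum fun i _ => Finset.sum_le_sum fun j _ => by
          rw [pow_two]; exact mul_le_mul_of_nonneg_left (hle i j) (ha0 i j)
    _ = sqSum x ^ 2 := by
        rw [hs, pow_two]
        simp only [← Finset.sum_mul]

/-- `aniso ≤ 1`. [folklore] -/
theorem aniso_le_one (x : Fin 4 → E³) : aniso x ≤ 1 := by
  unfold aniso
  rcases eq_or_lt_of_le (sq_nonneg (sqSum x)) with h | h
  · rw [← h, div_zero]; exact zero_le_one
  · rw [div_le_one h]; exact quartic_le_sqSum_sq x

/-! #### Symmetries and structure of the cubic decoy -/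

/-- The cubic decoy is translation invariant. [folklore] -/
theorem cubicFamily_isTranslationInvariant (Δ : ℝ) : IsTranslationInvariant (cubicFamily Δ) := by
  intro n v x
  match n, x with
  | 0, _ => rfl
  | 1, _ => rfl
  | 2, x => simp [cubicFamily_two, twoPt]
  | 3, _ => rfl
  | 4, x =>
    have hinj := injective_comp_iff (add_left_injective v) x
    by_cases hx : Function.Injective x
    · rw [cubicFamily_four_of_injective Δ (hinj.2 hx), cubicFamily_four_of_injective Δ hx,
        wick_add, bump_add, aniso_add]
    · rw [cubicFamily_four_of_not_injective Δ (mt hinj.1 hx),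
        cubicFamily_four_of_not_injective Δ hx]
  | (n + 5), _ => rfl

/-- The cubic decoy is scale covariant with dimension `Δ`. [folklore] -/
theorem cubicFamily_isScaleCovariant (Δ : ℝ) : IsScaleCovariant Δ (cubicFamily Δ) := by
  intro n c hc x
  match n, x with
  | 0, _ => simp [cubicFamily_zero]
  | 1, _ => simp [cubicFamily]
  | 2, x =>
    have h1 : (-((2 : ℕ) : ℝ) * Δ) = -(2 * Δ) := by push_cast; ring
    rw [cubicFamily_two, cubicFamily_two, h1, twoPt_smul Δ hc]
  | 3, _ => simp [cubicFamily]
  | 4, x =>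
    have h1 : (-((4 : ℕ) : ℝ) * Δ) = -(2 * Δ) + -(2 * Δ) := by push_cast; ring
    rw [h1, Real.rpow_add hc]
    have hinj := injective_comp_iff (smul_right_injective _ hc.ne') x
    by_cases hx : Function.Injective x
    · rw [cubicFamily_four_of_injective Δ (hinj.2 hx), cubicFamily_four_of_injective Δ hx,
        wick_smul Δ hc, bump_smul Δ hc, aniso_smul hc]
      ring
    · rw [cubicFamily_four_of_not_injective Δ (mt hinj.1 hx),
        cubicFamily_four_of_not_injective Δ hx, mul_zero]
  | (n + 5), _ => simp [cubicFamily]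

/-- The cubic decoy has vanishing odd correlations. [folklore] -/
theorem cubicFamily_odd (Δ : ℝ) {n : ℕ} (hn : Odd n) (x : Fin n → E³) : cubicFamily Δ n x = 0 := by
  match n, hn, x with
  | 0, hn, _ => exact absurd hn (by decide)
  | 2, hn, _ => exact absurd hn (by decide)
  | 4, hn, _ => exact absurd hn (by decide)
  | 1, _, _ => rfl
  | 3, _, _ => rfl
  | (n + 5), _, _ => rfl

/-- The cubic decoy is normalised: it vanishes on coincident configurations (`Δ ≠ 0`). [folklore] -/
theorem cubicFamily_eq_zero_of_not_mem {Δ : ℝ} (hΔ : Δ ≠ 0) (n : ℕ) (x : Fin n → E³)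
    (hx : x ∉ NonCoincident 3 n) : cubicFamily Δ n x = 0 := by
  rw [mem_nonCoincident] at hx
  match n, x, hx with
  | 0, x, hx => exact absurd (Function.injective_of_subsingleton x) hx
  | 1, _, _ => rfl
  | 2, x, hx =>
    rw [injective_fin_two_iff, not_not] at hx
    rw [cubicFamily_two, hx, twoPt_self hΔ]
  | 3, _, _ => rfl
  | 4, x, hx => exact cubicFamily_four_of_not_injective Δ hx
  | (n + 5), _, _ => rfl

/-- The cubic decoy has a non-degenerate two-point function. [folklore] -/
theorem cubicFamily_isNondegenerateTwoPoint (Δ : ℝ) : IsNondegenerateTwoPoint (cubicFamily Δ) := by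
  intro x hx
  rw [cubicFamily_two]
  exact twoPt_pos Δ ((injective_fin_two_iff x).1 ((mem_nonCoincident x).1 hx))

/-- The cubic decoy has an `O(3)`-invariant two-point kernel (H7): it is the exact conformal
two-point function `‖x‖^{-2Δ}`. [folklore] -/
theorem cubicFamily_twoPointIsotropic (Δ : ℝ) : TwoPointIsotropic (cubicFamily Δ) := by
  intro R x _
  rw [cubicFamily_two, cubicFamily_two]
  simp [twoPt]

/-- Indeed the whole two-point function of the decoy is `O(3)` invariant. [folklore] -/
theorem cubicFamily_two_rot (Δ : ℝ) (R : E³ ≃ₗᵢ[ℝ] E³) (x : Fin 2 → E³) :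
    cubicFamily Δ 2 (fun i => R (x i)) = cubicFamily Δ 2 x := by
  rw [cubicFamily_two, cubicFamily_two, twoPt_map]

/-- The cubic decoy is permutation symmetric (OS axiom E3). [folklore] -/
theorem cubicFamily_isPermutationSymmetric (Δ : ℝ) : IsPermutationSymmetric (cubicFamily Δ) := by
  intro n σ x
  match n, σ, x with
  | 0, _, _ => rfl
  | 1, _, _ => rfl
  | 3, _, _ => rfl
  | (n + 5), _, _ => rfl
  | 2, σ, x =>
    have h := narrowFamily_perm Δ 2 σ x
    rwa [narrowFamily_two, narrowFamily_two] at h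
  | 4, σ, x =>
    have hinj : Function.Injective (x ∘ σ) ↔ Function.Injective x := Equiv.injective_comp _ x
    by_cases hx : Function.Injective x
    · have hw : wick Δ (x ∘ σ) = wick Δ x := by
        have h := narrowFamily_perm Δ 4 σ x
        rw [narrowFamily_four_of_injective Δ (hinj.2 hx), narrowFamily_four_of_injective Δ hx,
          bump, bump, sqSum_comp_perm] at h
        linarith
      rw [cubicFamily_four_of_injective Δ (hinj.2 hx), cubicFamily_four_of_injective Δ hx, hw,
        bump, bump, sqSum_comp_perm, aniso_comp_perm]
    · rw [cubicFamily_four_of_not_injective Δ (mt hinj.1 hx), cubicFamily_four_of_not_injective Δ hx]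

/-- The cubic decoy is `B₃` invariant. [folklore] -/
theorem cubicFamily_isCubicInvariant (Δ : ℝ) : IsCubicInvariant (cubicFamily Δ) := by
  constructor
  · intro π n x
    match n, x with
    | 0, _ => rfl
    | 1, _ => rfl
    | 2, x => exact cubicFamily_two_rot Δ _ x
    | 3, _ => rfl
    | 4, x =>
      set P := LinearIsometryEquiv.piLpCongrLeft 2 ℝ ℝ π
      have hinj := injective_comp_iff P.injective x
      by_cases hx : Function.Injective x
      · rw [cubicFamily_four_of_injective Δ (hinj.2 hx), cubicFamily_four_of_injective Δ hx,
          wick_map, bump_map, aniso_coordPerm]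
      · rw [cubicFamily_four_of_not_injective Δ (mt hinj.1 hx), cubicFamily_four_of_not_injective Δ hx]
    | (n + 5), _ => rfl
  · intro ε R hR n x
    match n, x with
    | 0, _ => rfl
    | 1, _ => rfl
    | 2, x => exact cubicFamily_two_rot Δ R x
    | 3, _ => rfl
    | 4, x =>
      have hinj := injective_comp_iff R.injective x
      by_cases hx : Function.Injective x
      · rw [cubicFamily_four_of_injective Δ (hinj.2 hx), cubicFamily_four_of_injective Δ hx,
          wick_map, bump_map, aniso_signFlip ε R hR]
      · rw [cubicFamily_four_of_not_injective Δ (mt hinj.1 hx), cubicFamily_four_of_not_injective Δ hx]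
    | (n + 5), _ => rfl

/-- The connected four-point function of the decoy at a non-coincident quadruple is
`-bump · aniso`. [folklore] -/
theorem limitConnectedFour_cubicFamily (Δ : ℝ) {x : Fin 4 → E³} (hx : Function.Injective x) :
    limitConnectedFour (cubicFamily Δ) x = -(bump Δ x * aniso x) := by
  simp only [limitConnectedFour, cubicFamily_four_of_injective Δ hx, cubicFamily_two, wick,
    Matrix.cons_val_zero, Matrix.cons_val_one]
  ring

/-- At a coincident quadruple the connected function is minus the Wick sum. [folklore] -/
theorem limitConnectedFour_cubicFamily_of_not_injective (Δ : ℝ) {x : Fin 4 → E³}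
    (hx : ¬ Function.Injective x) : limitConnectedFour (cubicFamily Δ) x = -wick Δ x := by
  simp only [limitConnectedFour, cubicFamily_four_of_not_injective Δ hx, cubicFamily_two, wick,
    Matrix.cons_val_zero, Matrix.cons_val_one]
  ring

/-- Lebowitz sign: `U₄ ≤ 0` everywhere for the decoy. [folklore] -/
theorem limitConnectedFour_cubicFamily_nonpos (Δ : ℝ) (x : Fin 4 → E³) :
    limitConnectedFour (cubicFamily Δ) x ≤ 0 := by
  by_cases hx : Function.Injective x
  · rw [limitConnectedFour_cubicFamily Δ hx, neg_nonpos]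
    exact mul_nonneg (bump_nonneg Δ x) (aniso_nonneg x)
  · rw [limitConnectedFour_cubicFamily_of_not_injective Δ hx, neg_nonpos]
    exact wick_nonneg Δ x

/-- Aizenman–Griffiths-type domination: `|U₄| ≤ S₂(xᵢ,xⱼ)²` for every pair (`Δ ≥ 0`). [folklore] -/
theorem abs_limitConnectedFour_cubicFamily_le {Δ : ℝ} (hΔ : 0 ≤ Δ) {x : Fin 4 → E³}
    (hx : x ∈ NonCoincident 3 4) {i j : Fin 4} (hij : i ≠ j) :
    |limitConnectedFour (cubicFamily Δ) x| ≤ cubicFamily Δ 2 ![x i, x j] ^ 2 := by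
  have hinj : Function.Injective x := (mem_nonCoincident x).1 hx
  rw [limitConnectedFour_cubicFamily Δ hinj, abs_neg, cubicFamily_two,
    abs_of_nonneg (mul_nonneg (bump_nonneg Δ x) (aniso_nonneg x))]
  simp only [Matrix.cons_val_zero, Matrix.cons_val_one]
  calc bump Δ x * aniso x ≤ bump Δ x * 1 :=
        mul_le_mul_of_nonneg_left (aniso_le_one x) (bump_nonneg Δ x)
    _ ≤ twoPt Δ (x i) (x j) ^ 2 := by rw [mul_one]; exact bump_le_twoPt_sq hΔ (hinj.ne hij)

/-- `|U₄| ≤ bump` everywhere off the coincident locus. [folklore] -/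
theorem abs_limitConnectedFour_cubicFamily_le_bump (Δ : ℝ) {x : Fin 4 → E³}
    (hx : Function.Injective x) : |limitConnectedFour (cubicFamily Δ) x| ≤ bump Δ x := by
  rw [limitConnectedFour_cubicFamily Δ hx, abs_neg,
    abs_of_nonneg (mul_nonneg (bump_nonneg Δ x) (aniso_nonneg x))]
  calc bump Δ x * aniso x ≤ bump Δ x * 1 :=
        mul_le_mul_of_nonneg_left (aniso_le_one x) (bump_nonneg Δ x)
    _ = bump Δ x := mul_one _

/-- The bump of a quadruple whose second pair is translated far away tends to `0` (`Δ > 0`).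
[folklore] -/
theorem tendsto_bump_translate {Δ : ℝ} (hΔ : 0 < Δ) (x₀ x₁ y₀ y₁ : E³) :
    Tendsto (fun a : E³ => bump Δ ![x₀, x₁, y₀ + a, y₁ + a]) (cocompact E³) (𝓝 0) := by
  -- `‖x₀ - (y₀ + a)‖ → ∞`
  have hg : Tendsto (fun a : E³ => ‖x₀ - (y₀ + a)‖) (cocompact E³) atTop := by
    have h1 : Tendsto (fun a : E³ => ‖a‖ + -‖x₀ - y₀‖) (cocompact E³) atTop :=
      tendsto_atTop_add_const_right _ _ tendsto_norm_cocompact_atTop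
    refine tendsto_atTop_mono (fun a => ?_) h1
    have : ‖a‖ ≤ ‖x₀ - y₀‖ + ‖x₀ - (y₀ + a)‖ := by
      calc ‖a‖ = ‖(x₀ - y₀) - (x₀ - (y₀ + a))‖ := by congr 1; abel
        _ ≤ ‖x₀ - y₀‖ + ‖x₀ - (y₀ + a)‖ := norm_sub_le _ _
    linarith
  -- `sqSum ≥ ‖x₀ - (y₀ + a)‖² → ∞`
  have hsq : Tendsto (fun a : E³ => sqSum ![x₀, x₁, y₀ + a, y₁ + a]) (cocompact E³) atTop := by
    have h2 : Tendsto (fun a : E³ => ‖x₀ - (y₀ + a)‖ ^ 2) (cocompact E³) atTop :=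
      (tendsto_pow_atTop two_ne_zero).comp hg
    refine tendsto_atTop_mono (fun a => ?_) h2
    have := norm_sub_sq_le_sqSum ![x₀, x₁, y₀ + a, y₁ + a] 0 2
    simpa using this
  have h3 := (tendsto_rpow_neg_atTop (by positivity : 0 < 2 * Δ)).comp hsq
  refine h3.congr fun a => ?_
  simp [bump, Function.comp]

/-- A quadruple with distinct `x₀ ≠ x₁`, `y₀ ≠ y₁` and the second pair translated by `a` is
injective as soon as `a` avoids four points. [folklore] -/
theorem injective_translate_quad {x₀ x₁ y₀ y₁ a : E³} (hx : x₀ ≠ x₁) (hy : y₀ ≠ y₁)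
    (h00 : y₀ + a ≠ x₀) (h01 : y₀ + a ≠ x₁) (h10 : y₁ + a ≠ x₀) (h11 : y₁ + a ≠ x₁) :
    Function.Injective ![x₀, x₁, y₀ + a, y₁ + a] := by
  have hyy : y₀ + a ≠ y₁ + a := fun h => hy (add_right_cancel h)
  intro i j hij
  fin_cases i <;> fin_cases j <;> simp at hij <;> first
    | rfl
    | exact absurd hij hx | exact absurd hij.symm hx
    | exact absurd hij.symm h00 | exact absurd hij h00
    | exact absurd hij.symm h01 | exact absurd hij h01
    | exact absurd hij.symm h10 | exact absurd hij h10
    | exact absurd hij.symm h11 | exact absurd hij h11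
    | exact absurd hij hyy | exact absurd hij.symm hyy
    | exact absurd hij hy | exact absurd hij.symm hy

/-- Eventually along `cocompact`, the translated quadruple is injective. [folklore] -/
theorem eventually_injective_translate {x₀ x₁ y₀ y₁ : E³} (hx : x₀ ≠ x₁) (hy : y₀ ≠ y₁) :
    ∀ᶠ a in cocompact E³, Function.Injective ![x₀, x₁, y₀ + a, y₁ + a] := by
  have hbig : ∀ᶠ a : E³ in cocompact E³, ‖x₀ - y₀‖ + ‖x₁ - y₀‖ + ‖x₀ - y₁‖ + ‖x₁ - y₁‖ < ‖a‖ :=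
    tendsto_norm_cocompact_atTop.eventually_gt_atTop _
  filter_upwards [hbig] with a ha
  refine injective_translate_quad hx hy ?_ ?_ ?_ ?_ <;> intro h
  · have : a = x₀ - y₀ := by rw [← h]; abel
    rw [this] at ha
    linarith [norm_nonneg (x₁ - y₀), norm_nonneg (x₀ - y₁), norm_nonneg (x₁ - y₁)]
  · have : a = x₁ - y₀ := by rw [← h]; abel
    rw [this] at ha
    linarith [norm_nonneg (x₀ - y₀), norm_nonneg (x₀ - y₁), norm_nonneg (x₁ - y₁)]
  · have : a = x₀ - y₁ := by rw [← h]; abel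
    rw [this] at ha
    linarith [norm_nonneg (x₀ - y₀), norm_nonneg (x₁ - y₀), norm_nonneg (x₁ - y₁)]
  · have : a = x₁ - y₁ := by rw [← h]; abel
    rw [this] at ha
    linarith [norm_nonneg (x₀ - y₀), norm_nonneg (x₁ - y₀), norm_nonneg (x₀ - y₁)]

/-- **Clustering (OS axiom E4 shape) of the decoy**: the connected four-point function tends to
`0` when one pair is translated to infinity (`Δ > 0`). So clustering joins the blocked class too.
[folklore] -/
theorem cubicFamily_cluster {Δ : ℝ} (hΔ : 0 < Δ) {x₀ x₁ y₀ y₁ : E³} (hx : x₀ ≠ x₁) (hy : y₀ ≠ y₁) :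
    Tendsto (fun a : E³ => limitConnectedFour (cubicFamily Δ) ![x₀, x₁, y₀ + a, y₁ + a])
      (cocompact E³) (𝓝 0) := by
  refine squeeze_zero_norm' ?_ (tendsto_bump_translate hΔ x₀ x₁ y₀ y₁)
  filter_upwards [eventually_injective_translate hx hy] with a ha
  rw [Real.norm_eq_abs]
  exact abs_limitConnectedFour_cubicFamily_le_bump Δ ha

/-- Griffiths-I shape: all correlations of the decoy are `≥ 0` (`Δ ≥ 0`). [folklore] -/
theorem cubicFamily_nonneg {Δ : ℝ} (hΔ : 0 ≤ Δ) (n : ℕ) (x : Fin n → E³) : 0 ≤ cubicFamily Δ n x := by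
  match n, x with
  | 0, _ => exact zero_le_one
  | 1, _ => exact le_rfl
  | 2, x => rw [cubicFamily_two]; exact twoPt_nonneg Δ _ _
  | 3, _ => exact le_rfl
  | 4, x =>
    by_cases hx : Function.Injective x
    · rw [cubicFamily_four_of_injective Δ hx]
      have h01 : x 0 ≠ x 1 := hx.ne (by decide)
      have h23 : x 2 ≠ x 3 := hx.ne (by decide)
      have hb : bump Δ x * aniso x ≤ twoPt Δ (x 0) (x 1) * twoPt Δ (x 2) (x 3) :=
        calc bump Δ x * aniso x ≤ bump Δ x * 1 :=
              mul_le_mul_of_nonneg_left (aniso_le_one x) (bump_nonneg Δ x)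
          _ ≤ twoPt Δ (x 0) (x 1) * twoPt Δ (x 2) (x 3) := by
              rw [mul_one]; exact bump_le_twoPt_mul_twoPt hΔ h01 h23
      have hw := twoPt_nonneg Δ
      unfold wick
      nlinarith [hw (x 0) (x 2), hw (x 1) (x 3), hw (x 0) (x 3), hw (x 1) (x 2),
        mul_nonneg (hw (x 0) (x 2)) (hw (x 1) (x 3)), mul_nonneg (hw (x 0) (x 3)) (hw (x 1) (x 2))]
    · rw [cubicFamily_four_of_not_injective Δ hx]
  | (n + 5), _ => exact le_rfl

/-! #### The decoy is NOT rotation invariant: an explicit orthogonal map outside `B₃` applied to a collinear quadruple -/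

/-- The unit vector `u = (3/5, 4/5, 0)` (a rational point of the sphere off the cubic axes and
diagonals). [folklore] -/
def uDir : E³ := WithLp.toLp 2 ![3 / 5, 4 / 5, 0]

/-- `‖u‖ = 1`. [folklore] -/
theorem norm_uDir : ‖uDir‖ = 1 := by
  rw [EuclideanSpace.norm_eq, Fin.sum_univ_three]
  have h0 : ‖uDir 0‖ ^ 2 = 9 / 25 := by simp [uDir]; norm_num
  have h1 : ‖uDir 1‖ ^ 2 = 16 / 25 := by simp [uDir]; norm_num
  have h2 : ‖uDir 2‖ ^ 2 = 0 := by simp [uDir]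
  rw [h0, h1, h2]
  norm_num

/-- The isometry `R₀`: the reflection swapping `e₀` and `u` (Mathlib `Submodule.reflection_sub`);
`-R₀ ∈ SO(3)` acts identically on every limit (`neg_free`). [folklore] -/
def R₀ : E³ ≃ₗᵢ[ℝ] E³ := (ℝ ∙ (axisUnit - uDir))ᗮ.reflection

/-- `R₀ e₀ = u`. [folklore] -/
theorem R₀_axisUnit : R₀ axisUnit = uDir :=
  Submodule.reflection_sub (by rw [norm_axisUnit, norm_uDir])

/-- `R₀ (t e₀) = t u`. [folklore] -/
theorem R₀_axisPt (t : ℝ) : R₀ (axisPt t) = t • uDir := by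
  rw [axisPt, LinearIsometryEquiv.map_smul, R₀_axisUnit]

/-- The collinear test quadruple `0, e₀, 2e₀, 3e₀` as multiples of `e₀`. [folklore] -/
theorem configU4_eq : configU4 = fun i => (![0, 1, 2, 3] : Fin 4 → ℝ) i • axisUnit := by
  funext i
  fin_cases i <;> simp [configU4, axisPt]

/-- Its image under `R₀`: `0, u, 2u, 3u`. [folklore] -/
theorem R₀_configU4 : (fun i => R₀ (configU4 i)) = fun i => (![0, 1, 2, 3] : Fin 4 → ℝ) i • uDir := by
  funext i
  fin_cases i <;> simp [configU4, R₀_axisPt]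

/-- `∑ᵢⱼ (tᵢ - tⱼ)⁴ = 232` for `t = (0,1,2,3)`. [folklore] -/
theorem sum_t_four : (∑ i : Fin 4, ∑ j : Fin 4,
    ((![0, 1, 2, 3] : Fin 4 → ℝ) i - (![0, 1, 2, 3] : Fin 4 → ℝ) j) ^ 4) = 232 := by
  simp [Fin.sum_univ_four]
  norm_num

/-- `∑ₖ (e₀)ₖ⁴ = 1`. [folklore] -/
theorem sum4_axisUnit : ∑ k, (axisUnit k) ^ 4 = 1 := by
  simp [axisUnit]

/-- `∑ₖ uₖ⁴ = 337/625 ≠ 1`: the quartic cubic invariant separates `u` from the axes. [folklore] -/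
theorem sum4_uDir : ∑ k, (uDir k) ^ 4 = 337 / 625 := by
  simp [uDir, Fin.sum_univ_three]
  norm_num

/-- `quartic` at the collinear quadruple. [folklore] -/
theorem quartic_configU4 : quartic configU4 = 232 := by
  rw [configU4_eq, quartic_line, sum_t_four, sum4_axisUnit, mul_one]

/-- `quartic` at the rotated quadruple. [folklore] -/
theorem quartic_R₀_configU4 : quartic (fun i => R₀ (configU4 i)) = 232 * (337 / 625) := by
  rw [R₀_configU4, quartic_line, sum_t_four, sum4_uDir]

/-- **The decoy's `S₄` is not invariant under `R₀`** (for EVERY `Δ`). [folklore] -/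
theorem cubicFamily_four_R₀_ne (Δ : ℝ) :
    cubicFamily Δ 4 (fun i => R₀ (configU4 i)) ≠ cubicFamily Δ 4 configU4 := by
  have hinj := configU4_injective
  have hinjR : Function.Injective (fun i => R₀ (configU4 i)) :=
    (injective_comp_iff R₀.injective _).2 hinj
  rw [cubicFamily_four_of_injective Δ hinjR, cubicFamily_four_of_injective Δ hinj, wick_map, bump_map,
    aniso, aniso, sqSum_map, quartic_configU4, quartic_R₀_configU4]
  have hb : 0 < bump Δ configU4 := bump_pos Δ hinj
  have hs : 0 < sqSum configU4 ^ 2 := pow_pos (sqSum_pos hinj) 2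
  intro h
  have h1 : bump Δ configU4 * (232 * (337 / 625) / sqSum configU4 ^ 2) =
      bump Δ configU4 * (232 / sqSum configU4 ^ 2) := by linarith
  have h2 := mul_left_cancel₀ hb.ne' h1
  rw [div_eq_div_iff hs.ne' hs.ne'] at h2
  nlinarith

/-- **The cubic decoy is not rotation invariant.** [folklore] -/
theorem cubicFamily_not_isRotationInvariant (Δ : ℝ) : ¬ IsRotationInvariant (cubicFamily Δ) :=
  fun h => cubicFamily_four_R₀_ne Δ (h 4 R₀ configU4)

/-- … and more precisely its CONNECTED four-point function is not. [folklore] -/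
theorem limitConnectedFour_cubicFamily_R₀_ne (Δ : ℝ) :
    limitConnectedFour (cubicFamily Δ) (fun i => R₀ (configU4 i)) ≠
      limitConnectedFour (cubicFamily Δ) configU4 := by
  intro h
  have := limitConnectedFour_rot_sub (cubicFamily_isTranslationInvariant Δ)
    (cubicFamily_twoPointIsotropic Δ) R₀ configU4
  rw [h, sub_self] at this
  exact cubicFamily_four_R₀_ne Δ (by linarith)

/-! #### Continuity and lattice provenance of the decoy -/

/-- `quartic` is continuous. [folklore] -/
theorem continuous_quartic : Continuous quartic := by
  unfold quartic
  fun_prop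

/-- `aniso` is continuous on non-coincident quadruples. [folklore] -/
theorem continuousOn_aniso : ContinuousOn aniso (NonCoincident 3 4) := by
  unfold aniso
  refine continuous_quartic.continuousOn.div (continuous_sqSum.pow 2).continuousOn fun x hx => ?_
  exact pow_ne_zero 2 (sqSum_pos ((mem_nonCoincident x).1 hx)).ne'

/-- The decoy is continuous on non-coincident configurations, in every arity. [folklore] -/
theorem continuousOn_cubicFamily (Δ : ℝ) (n : ℕ) :
    ContinuousOn (cubicFamily Δ n) (NonCoincident 3 n) := by
  match n with
  | 0 => exact continuousOn_const
  | 1 => exact continuousOn_const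
  | 2 =>
    refine ((continuousOn_twoPt Δ (0 : Fin 2) 1).mono fun x hx => ?_).congr
      fun x _ => cubicFamily_two Δ x
    exact (injective_fin_two_iff x).1 ((mem_nonCoincident x).1 hx)
  | 3 => exact continuousOn_const
  | 4 =>
    have hinj : ∀ x ∈ NonCoincident 3 4, Function.Injective x := fun x hx => (mem_nonCoincident x).1 hx
    have heq : Set.EqOn (cubicFamily Δ 4) (fun x => wick Δ x - bump Δ x * aniso x) (NonCoincident 3 4) :=
      fun x hx => cubicFamily_four_of_injective Δ (hinj x hx)
    refine ContinuousOn.congr ?_ heq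
    have htp : ∀ i j : Fin 4, i ≠ j →
        ContinuousOn (fun x : Fin 4 → E³ => twoPt Δ (x i) (x j)) (NonCoincident 3 4) :=
      fun i j hij => (continuousOn_twoPt Δ i j).mono fun x hx h => hij (hinj x hx h)
    refine ContinuousOn.sub ?_ (ContinuousOn.mul ?_ continuousOn_aniso)
    · unfold wick
      exact (((htp 0 1 (by decide)).mul (htp 2 3 (by decide))).add
        ((htp 0 2 (by decide)).mul (htp 1 3 (by decide)))).add
        ((htp 0 3 (by decide)).mul (htp 1 2 (by decide)))
    · unfold bump
      exact ContinuousOn.rpow_const (continuous_sqSum.continuousOn) fun x hx =>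
        Or.inl (sqSum_pos (hinj x hx)).ne'
  | (n + 5) => exact continuousOn_const

/-- The decoy sampled on `ℤ³`: its lattice precursor. [folklore] -/
def cubicLattice (Δ : ℝ) : LatticeCorrFamily 3 := fun n k =>
  cubicFamily Δ n (fun i => (WithLp.toLp 2 fun j => ((k i j : ℤ) : ℝ) : E³))

/-- **The cubic decoy is a lattice scaling limit**: with `ρ δ = δ^{-Δ}`,
`HasPointwiseScalingLimit (cubicLattice Δ) ρ (cubicFamily Δ)` (scale covariance turns the rescaled
correlator into the decoy at the rounded configuration; continuity on `NonCoincident` and the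
`3δ` rounding bound give locally uniform convergence — the barrier's approximation lemma).
[folklore] -/
theorem cubicFamily_hasPointwiseScalingLimit (Δ : ℝ) :
    HasPointwiseScalingLimit (cubicLattice Δ) (fun δ => δ ^ (-Δ)) (cubicFamily Δ) := by
  intro n
  have key : ∀ δ, 0 < δ → ∀ x : Fin n → E³,
      rescaledCorrelator (cubicLattice Δ) (fun δ => δ ^ (-Δ)) n δ x =
        cubicFamily Δ n (fun i => δ • (WithLp.toLp 2 fun j => ((latticeApprox δ (x i) j : ℤ) : ℝ) : E³)) := by
    intro δ hδ x
    rw [rescaledCorrelator_apply, cubicFamily_isScaleCovariant Δ n δ hδ]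
    unfold cubicLattice
    congr 1
    rw [← Real.rpow_natCast, ← Real.rpow_mul hδ.le]
    congr 1
    ring
  have happrox := tendstoLocallyUniformlyOn_comp_approx (isOpen_nonCoincident 3 n)
    (continuousOn_cubicFamily Δ n)
    (fun δ x i => δ • (WithLp.toLp 2 fun j => ((latticeApprox δ (x i) j : ℤ) : ℝ) : E³)) 3
    (fun δ hδ x => dist_round_le hδ x)
  refine tendstoLocallyUniformlyOn_congr_eventually happrox ?_
  filter_upwards [self_mem_nhdsWithin] with δ hδ x _
  exact (key δ hδ x).symm

/-! ### (H2) is load-bearing, and cannot be weakened to lattice provenance + all generic lattice structure -/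

/-- The crux with the LATTICE CLAUSES (H1)+(H2) deleted (model-blind upgrade at weight `Δ`). [folklore] -/
def CruxWithoutIsingLimit (Δ : ℝ) : Prop :=
  ∀ S : CorrFamily 3, (∀ n z, z ∉ NonCoincident 3 n → S n z = 0) → IsNondegenerateTwoPoint S →
    IsTranslationInvariant S → IsScaleCovariant Δ S → TwoPointIsotropic S → IsRotationInvariant S

/-- **(H2) is load-bearing at EVERY `Δ ≠ 0`** (in particular on the whole window `[1/2, 1]` and at
the bootstrap value `Δ_σ ≈ 0.518`): two-point isotropy + translations + dilations + normalisation
+ non-degeneracy do not touch `S₄`. Witness `cubicFamily Δ`. [folklore] -/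
theorem not_cruxWithoutIsingLimit {Δ : ℝ} (hΔ : Δ ≠ 0) : ¬ CruxWithoutIsingLimit Δ := fun h =>
  cubicFamily_not_isRotationInvariant Δ (h _ (cubicFamily_eq_zero_of_not_mem hΔ)
    (cubicFamily_isNondegenerateTwoPoint Δ) (cubicFamily_isTranslationInvariant Δ)
    (cubicFamily_isScaleCovariant Δ) (cubicFamily_twoPointIsotropic Δ))

/-- The crux with `criticalCorr 3` weakened to an ARBITRARY lattice family `G` AND decorated with
every generic lattice structure that survives a scaling limit and is formalised in the tree:
`B₃` invariance, permutation symmetry, positivity (Griffiths I), the Lebowitz sign `U₄ ≤ 0`, the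
Aizenman–Griffiths domination `|U₄| ≤ S₂²`, continuity off the diagonals, clustering of `U₄`
(OS E4 shape). [folklore] -/
def CruxWithCubicLatticeLimit (Δ : ℝ) : Prop :=
  ∀ (G : LatticeCorrFamily 3) (ρ : ℝ → ℝ) (S : CorrFamily 3), (∀ δ ∈ Set.Ioc (0:ℝ) 1, 0 < ρ δ) →
    HasPointwiseScalingLimit G ρ S → (∀ n z, z ∉ NonCoincident 3 n → S n z = 0) →
    IsNondegenerateTwoPoint S → IsTranslationInvariant S → IsScaleCovariant Δ S →
    TwoPointIsotropic S → IsCubicInvariant S → IsPermutationSymmetric S → (∀ n x, 0 ≤ S n x) →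
    (∀ x, limitConnectedFour S x ≤ 0) →
    (∀ x ∈ NonCoincident 3 4, ∀ i j : Fin 4, i ≠ j → |limitConnectedFour S x| ≤ S 2 ![x i, x j] ^ 2) →
    (∀ n, ContinuousOn (S n) (NonCoincident 3 n)) →
    (∀ x₀ x₁ y₀ y₁ : E³, x₀ ≠ x₁ → y₀ ≠ y₁ →
      Tendsto (fun a : E³ => limitConnectedFour S ![x₀, x₁, y₀ + a, y₁ + a]) (cocompact E³) (𝓝 0)) →
    IsRotationInvariant S

/-- **Lattice provenance and all generic lattice structure do not rescue (H2)** (`Δ > 0`): the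
cubic decoy is the scaling limit of its own sampling on `ℤ³` and has every listed property. So a
proof of the crux must use a property of `criticalCorr 3` that `cubicFamily Δ` LACKS — see the
docblock (OS positivity of all orders jointly, the random-current representation of `U₄`,
`criticalCorr`-specific identities). [folklore] -/
theorem not_cruxWithCubicLatticeLimit {Δ : ℝ} (hΔ : 0 < Δ) : ¬ CruxWithCubicLatticeLimit Δ := by
  intro h
  refine cubicFamily_not_isRotationInvariant Δ (h (cubicLattice Δ) (fun δ => δ ^ (-Δ)) (cubicFamily Δ)
    (fun δ hδ => Real.rpow_pos_of_pos hδ.1 _) (cubicFamily_hasPointwiseScalingLimit Δ)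
    (cubicFamily_eq_zero_of_not_mem hΔ.ne') (cubicFamily_isNondegenerateTwoPoint Δ)
    (cubicFamily_isTranslationInvariant Δ) (cubicFamily_isScaleCovariant Δ)
    (cubicFamily_twoPointIsotropic Δ) (cubicFamily_isCubicInvariant Δ)
    (cubicFamily_isPermutationSymmetric Δ) (cubicFamily_nonneg hΔ.le)
    (limitConnectedFour_cubicFamily_nonpos Δ)
    (fun x hx i j hij => abs_limitConnectedFour_cubicFamily_le hΔ.le hx hij)
    (continuousOn_cubicFamily Δ) (fun x₀ x₁ y₀ y₁ hx hy => cubicFamily_cluster hΔ hx hy))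

/-- The intermediate weakening (lattice provenance only) is false as well. [folklore] -/
theorem not_cruxWithLatticeLimit {Δ : ℝ} (hΔ : Δ ≠ 0) :
    ¬ ∀ (G : LatticeCorrFamily 3) (ρ : ℝ → ℝ) (S : CorrFamily 3), (∀ δ ∈ Set.Ioc (0:ℝ) 1, 0 < ρ δ) →
      HasPointwiseScalingLimit G ρ S → (∀ n z, z ∉ NonCoincident 3 n → S n z = 0) →
      IsNondegenerateTwoPoint S → IsTranslationInvariant S → IsScaleCovariant Δ S →
      TwoPointIsotropic S → IsRotationInvariant S := by
  intro h
  exact cubicFamily_not_isRotationInvariant Δ (h (cubicLattice Δ) (fun δ => δ ^ (-Δ)) (cubicFamily Δ)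
    (fun δ hδ => Real.rpow_pos_of_pos hδ.1 _) (cubicFamily_hasPointwiseScalingLimit Δ)
    (cubicFamily_eq_zero_of_not_mem hΔ) (cubicFamily_isNondegenerateTwoPoint Δ)
    (cubicFamily_isTranslationInvariant Δ) (cubicFamily_isScaleCovariant Δ)
    (cubicFamily_twoPointIsotropic Δ))


/-! ### The cubic decoy is NOT reflection positive: OS positivity stays an admissible lever -/

/-- `S₄ > 0` of the decoy at non-coincident quadruples (`Δ ≥ 0`). [folklore] -/
theorem cubicFamily_four_pos {Δ : ℝ} (hΔ : 0 ≤ Δ) {x : Fin 4 → E³} (hx : Function.Injective x) :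
    0 < cubicFamily Δ 4 x := by
  rw [cubicFamily_four_of_injective Δ hx]
  have h01 : x 0 ≠ x 1 := hx.ne (by decide)
  have h23 : x 2 ≠ x 3 := hx.ne (by decide)
  have h02 : x 0 ≠ x 2 := hx.ne (by decide)
  have h13 : x 1 ≠ x 3 := hx.ne (by decide)
  have hb : bump Δ x * aniso x ≤ twoPt Δ (x 0) (x 1) * twoPt Δ (x 2) (x 3) :=
    calc bump Δ x * aniso x ≤ bump Δ x * 1 :=
          mul_le_mul_of_nonneg_left (aniso_le_one x) (bump_nonneg Δ x)
      _ ≤ twoPt Δ (x 0) (x 1) * twoPt Δ (x 2) (x 3) := by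
          rw [mul_one]; exact bump_le_twoPt_mul_twoPt hΔ h01 h23
  have hpos : 0 < twoPt Δ (x 0) (x 2) * twoPt Δ (x 1) (x 3) :=
    mul_pos (twoPt_pos Δ h02) (twoPt_pos Δ h13)
  have hw := twoPt_nonneg Δ
  unfold wick
  nlinarith [mul_nonneg (hw (x 0) (x 3)) (hw (x 1) (x 2))]

/-- **The cubic decoy is NOT reflection positive** along any coordinate axis (`Δ ≥ 0`): as for the
barrier witness, the OS Gram matrix of "three spins at `e_τ,2e_τ,3e_τ`" versus "one spin at `4e_τ`"
has diagonal entry `S₆ = 0` and positive off-diagonal entries `S₄ > 0` (OS Cauchy–Schwarz). So the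
no-go class of §3 is DISJOINT from reflection positivity: nine-mirror OS positivity of all orders
(the route's intended engine "NineDirectionOS → ContinuationB3") is untouched by it. [folklore] -/
theorem cubicFamily_not_reflectionPositive {Δ : ℝ} (hΔ : 0 ≤ Δ) (τ : Fin 3) :
    ¬ IsReflectionPositiveAlong τ (cubicFamily Δ) := by
  intro hRP
  let A : HalfSpaceConfig 3 τ :=
    { n := 3
      pts := fun i => EuclideanSpace.single τ (((i : ℕ) : ℝ) + 1)
      injective := by
        intro i j hij
        have h : ((i : ℕ) : ℝ) + 1 = ((j : ℕ) : ℝ) + 1 := by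
          simpa using congrArg (fun z : EuclideanSpace ℝ (Fin 3) => z τ) hij
        exact Fin.ext (Nat.cast_injective (R := ℝ) (by linarith))
      pos := fun i => by simp; positivity }
  let B : HalfSpaceConfig 3 τ :=
    { n := 1
      pts := fun _ => EuclideanSpace.single τ 4
      injective := Function.injective_of_subsingleton _
      pos := fun i => by simp }
  have hAA : osPointKernel (cubicFamily Δ) A A = 0 := rfl
  have hAB : 0 < osPointKernel (cubicFamily Δ) A B :=
    cubicFamily_four_pos hΔ (osPointKernel_arg_injective A B)
  have hBA : 0 < osPointKernel (cubicFamily Δ) B A :=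
    cubicFamily_four_pos hΔ (osPointKernel_arg_injective B A)
  have hBB : 0 < osPointKernel (cubicFamily Δ) B B := by
    have hinj := osPointKernel_arg_injective B B
    show 0 < cubicFamily Δ 2 _
    rw [cubicFamily_two]
    exact twoPt_pos Δ (hinj.ne (show (0 : Fin 2) ≠ 1 by decide))
  set s := osPointKernel (cubicFamily Δ) A B with hs
  set s' := osPointKernel (cubicFamily Δ) B A with hs'
  set t := osPointKernel (cubicFamily Δ) B B with ht
  have key := hRP 2 ![A, B] ![t, -(s + s') / 2]
  simp only [Fin.sum_univ_two, Matrix.cons_val_zero, Matrix.cons_val_one] at key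
  rw [hAA, ← hs, ← hs', ← ht] at key
  nlinarith [mul_pos hBB (mul_pos (add_pos hAB hBA) (add_pos hAB hBA))]

/-! ### (H3) is load-bearing (given that the intended object exists at all) -/

/-- The crux with the NORMALISATION (H3) deleted. [folklore] -/
def CruxWithoutNormalisation : Prop :=
  ∀ (ρ : ℝ → ℝ) (Δ : ℝ) (S : CorrFamily 3), (∀ δ ∈ Set.Ioc (0:ℝ) 1, 0 < ρ δ) →
    HasPointwiseScalingLimit (criticalCorr 3) ρ S → IsNondegenerateTwoPoint S →
    IsTranslationInvariant S → IsScaleCovariant Δ S → TwoPointIsotropic S → IsRotationInvariant S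

open Classical in
/-- A decoration living on the COINCIDENT locus of order `3`: `0` at injective triples, and
`((x₂-x₀)₀)²/‖x₂-x₀‖² · ‖x₂-x₀‖^{-3Δ}` (translation invariant, degree `-3Δ`, cubic but not round)
otherwise. [folklore] -/
def decor (Δ : ℝ) (x : Fin 3 → E³) : ℝ :=
  if Function.Injective x then 0
  else ((x 2 - x 0) 0) ^ 2 / ‖x 2 - x 0‖ ^ 2 * twoPt (3 * Δ / 2) (x 0) (x 2)

/-- `S` decorated at order `3` on the coincident locus. [folklore] -/
def decorate (Δ : ℝ) (S : CorrFamily 3) : CorrFamily 3 := fun n =>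
  match n with
  | 0 => S 0
  | 1 => S 1
  | 2 => S 2
  | 3 => fun x => S 3 x + decor Δ x
  | (n + 4) => S (n + 4)

/-- The decoration vanishes at injective triples. [folklore] -/
theorem decor_of_injective (Δ : ℝ) {x : Fin 3 → E³} (hx : Function.Injective x) : decor Δ x = 0 := by
  rw [decor, if_pos hx]

/-- The decorated family agrees with `S` on non-coincident configurations. [folklore] -/
theorem decorate_eqOn (Δ : ℝ) (S : CorrFamily 3) (n : ℕ) :
    Set.EqOn (decorate Δ S n) (S n) (NonCoincident 3 n) := by
  intro x hx
  match n, x, hx with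
  | 0, _, _ => rfl
  | 1, _, _ => rfl
  | 2, _, _ => rfl
  | 3, x, hx =>
    show S 3 x + decor Δ x = S 3 x
    rw [decor_of_injective Δ ((mem_nonCoincident x).1 hx), add_zero]
  | (n + 4), _, _ => rfl

/-- Locally uniform convergence on a set only sees the limit function ON the set. [folklore] -/
theorem tendstoLocallyUniformlyOn_congr_limit {ι X : Type*} [TopologicalSpace X]
    {F : ι → X → ℝ} {f g : X → ℝ} {p : Filter ι} {s : Set X}
    (hF : TendstoLocallyUniformlyOn F f p s) (hfg : Set.EqOn f g s) :
    TendstoLocallyUniformlyOn F g p s := by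
  intro u hu x hx
  obtain ⟨t, ht, hFt⟩ := hF u hu x hx
  refine ⟨t ∩ s, inter_mem ht self_mem_nhdsWithin, ?_⟩
  filter_upwards [hFt] with n hn y hy
  rw [← hfg hy.2]
  exact hn y hy.1

/-- (H2) survives the decoration (it only constrains `S` on `NonCoincident`). [folklore] -/
theorem decorate_lim {G : LatticeCorrFamily 3} (Δ : ℝ) (hlim : HasPointwiseScalingLimit G ρ S) :
    HasPointwiseScalingLimit G ρ (decorate Δ S) := fun n =>
  tendstoLocallyUniformlyOn_congr_limit (hlim n) (decorate_eqOn Δ S n).symm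

/-- (H4) survives the decoration. [folklore] -/
theorem decorate_nondeg (Δ : ℝ) (hnd : IsNondegenerateTwoPoint S) :
    IsNondegenerateTwoPoint (decorate Δ S) := hnd

/-- The decoration is translation invariant. [folklore] -/
theorem decor_add (Δ : ℝ) (x : Fin 3 → E³) (v : E³) : decor Δ (fun i => x i + v) = decor Δ x := by
  have hinj := injective_comp_iff (add_left_injective v) x
  by_cases hx : Function.Injective x
  · rw [decor_of_injective Δ (hinj.2 hx), decor_of_injective Δ hx]
  · rw [decor, if_neg (mt hinj.1 hx), decor, if_neg hx, twoPt_add]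
    simp

/-- The decoration is homogeneous of degree `-3Δ`. [folklore] -/
theorem decor_smul (Δ : ℝ) {c : ℝ} (hc : 0 < c) (x : Fin 3 → E³) :
    decor Δ (fun i => c • x i) = c ^ (-((3 : ℕ) : ℝ) * Δ) * decor Δ x := by
  have hinj := injective_comp_iff (smul_right_injective _ hc.ne') x
  by_cases hx : Function.Injective x
  · rw [decor_of_injective Δ (hinj.2 hx), decor_of_injective Δ hx, mul_zero]
  · rw [decor, if_neg (mt hinj.1 hx), decor, if_neg hx, twoPt_smul _ hc]
    have hexp : (-(2 * (3 * Δ / 2))) = -((3 : ℕ) : ℝ) * Δ := by push_cast; ring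
    rw [hexp, ← smul_sub, norm_smul, Real.norm_eq_abs, abs_of_pos hc, PiLp.smul_apply, smul_eq_mul,
      mul_pow, mul_pow, mul_div_mul_left _ _ (pow_ne_zero 2 hc.ne')]
    ring

/-- (H5) survives the decoration. [folklore] -/
theorem decorate_transl (Δ : ℝ) (htr : IsTranslationInvariant S) :
    IsTranslationInvariant (decorate Δ S) := by
  intro n v x
  match n, x with
  | 0, x => exact htr 0 v x
  | 1, x => exact htr 1 v x
  | 2, x => exact htr 2 v x
  | 3, x =>
    show S 3 (fun i => x i + v) + decor Δ (fun i => x i + v) = S 3 x + decor Δ x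
    rw [htr 3 v x, decor_add]
  | (n + 4), x => exact htr (n + 4) v x

/-- (H6) survives the decoration. [folklore] -/
theorem decorate_scale (hsc : IsScaleCovariant Δ S) : IsScaleCovariant Δ (decorate Δ S) := by
  intro n c hc x
  match n, x with
  | 0, x => exact hsc 0 c hc x
  | 1, x => exact hsc 1 c hc x
  | 2, x => exact hsc 2 c hc x
  | 3, x =>
    show S 3 (fun i => c • x i) + decor Δ (fun i => c • x i) = _ * (S 3 x + decor Δ x)
    rw [hsc 3 c hc x, decor_smul Δ hc, mul_add]
  | (n + 4), x => exact hsc (n + 4) c hc x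

/-- (H7) survives the decoration (order `2` is untouched), given rotation invariance of `S`. [folklore] -/
theorem decorate_iso (Δ : ℝ) (hrot : IsRotationInvariant S) : TwoPointIsotropic (decorate Δ S) := by
  intro R x _
  show S 2 ![0, R x] = S 2 ![0, x]
  have h := hrot 2 R ![0, x]
  have hcfg : (fun i => R ((![0, x] : Fin 2 → E³) i)) = ![0, R x] := by
    funext i; fin_cases i <;> simp
  rw [hcfg] at h
  exact h

/-- The coincident test triple `(0, 0, e₀)`. [folklore] -/
def coincidentTriple : Fin 3 → E³ := ![0, 0, axisUnit]

/-- The coordinate swap `x₀ ↔ x₁` (an element of `B₃ ⊂ O(3)`). [folklore] -/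
def swap01 : E³ ≃ₗᵢ[ℝ] E³ := LinearIsometryEquiv.piLpCongrLeft 2 ℝ ℝ (Equiv.swap 0 1)

/-- The test triple is coincident. [folklore] -/
theorem not_injective_coincidentTriple : ¬ Function.Injective coincidentTriple := by
  intro h
  have : coincidentTriple 0 = coincidentTriple 1 := by simp [coincidentTriple]
  exact absurd (h this) (by decide)

/-- The decoration at the test triple is `1`. [folklore] -/
theorem decor_coincidentTriple (Δ : ℝ) : decor Δ coincidentTriple = 1 := by
  rw [decor, if_neg not_injective_coincidentTriple]
  simp [coincidentTriple, twoPt, axisUnit]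

/-- The decoration at the swapped test triple is `0`. [folklore] -/
theorem decor_swap_coincidentTriple (Δ : ℝ) :
    decor Δ (fun i => swap01 (coincidentTriple i)) = 0 := by
  have hninj : ¬ Function.Injective (fun i => swap01 (coincidentTriple i)) :=
    mt (injective_comp_iff swap01.injective _).1 not_injective_coincidentTriple
  rw [decor, if_neg hninj]
  have h0 : (swap01 (coincidentTriple 2) - swap01 (coincidentTriple 0)) 0 = 0 := by
    rw [← map_sub]
    simp [swap01, coincidentTriple, axisUnit]
  rw [h0]
  simp

/-- **The decorated limit is not rotation invariant** (although `S` is). [folklore] -/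
theorem decorate_not_rot (Δ : ℝ) (hrot : IsRotationInvariant S) : ¬ IsRotationInvariant (decorate Δ S) := by
  intro h
  have h3 := h 3 swap01 coincidentTriple
  change S 3 (fun i => swap01 (coincidentTriple i)) + decor Δ (fun i => swap01 (coincidentTriple i)) =
    S 3 coincidentTriple + decor Δ coincidentTriple at h3
  rw [hrot 3 swap01 coincidentTriple, decor_swap_coincidentTriple, decor_coincidentTriple] at h3
  linarith

/-- **(H3) is load-bearing**: granted that the intended object exists at all
(`CritIsing3DEuclideanLimit`: a Euclidean-invariant, scale-covariant, non-degenerate limit), the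
crux WITHOUT the normalisation is false — decorate `S₃` on the coincident locus, which (H2) does not
see. (Same mechanism as the refutation of item 0637, `not_inversionUpgrade_of_euclideanLimit`.)
[folklore] -/
theorem not_cruxWithoutNormalisation (hE : CritIsing3DEuclideanLimit) : ¬ CruxWithoutNormalisation := by
  obtain ⟨ρ, Δ, S, hρ, -, hlim, hnd, heuc, hsc⟩ := hE
  intro h
  exact decorate_not_rot Δ heuc.2 (h ρ Δ (decorate Δ S) hρ (decorate_lim Δ hlim)
    (decorate_nondeg Δ hnd) (decorate_transl Δ heuc.1) (decorate_scale hsc) (decorate_iso Δ heuc.2))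

/-- Conversely, WITH (H3) any Euclidean limit normalises to an instance of the hypotheses that IS
rotation invariant: so `CritIsing3DEuclideanLimit` makes the crux's hypotheses satisfiable (no
vacuity) and is consistent with it. [folklore] -/
theorem exists_hyp_of_euclideanLimit (hE : CritIsing3DEuclideanLimit) :
    ∃ (ρ : ℝ → ℝ) (Δ : ℝ) (S : CorrFamily 3), Hyp ρ Δ S ∧ IsRotationInvariant S := by
  classical
  obtain ⟨ρ, Δ, S, hρ, -, hlim, hnd, heuc, hsc⟩ := hE
  refine ⟨ρ, Δ, fun n x => if x ∈ NonCoincident 3 n then S n x else 0,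
    ⟨hρ, normalised_hasLimit hlim, fun n z hz => if_neg hz, normalised_nondeg hnd,
      normalised_translation heuc.1, normalised_scale hsc, ?_⟩, normalised_rotation heuc.2⟩
  intro R x hx
  have h := normalised_rotation heuc.2 2 R ![0, x]
  have hcfg : (fun i => R ((![0, x] : Fin 2 → E³) i)) = ![0, R x] := by
    funext i; fin_cases i <;> simp
  rw [hcfg] at h
  exact h

/-! ### (H1), (H4), (H6), (H7): what dropping them does

* (H5), (H6), `Δ`: redundant (`crux_iff_core`) — dropping them changes nothing.
* (H1) enters only through `scale_redundant` / `delta_mem_Icc` (the sign of `ρ` is invisible to even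
  orders and odd orders vanish); it cannot be dropped-and-refuted without the limit.
* (H4): NOT load-bearing — `crux_iff_withoutNondegeneracy` (§1): degenerate instances are trivial.
* (H7) dropped = full isotropy from nothing = HyperoctahedralRP's `LimitRotationInvariant`-type
  statement (shared fate); not refutable without the limit either.
-/

/-! ## §4 Near-misses / open (the only `sorry`s of this file) -/

/-- **OPEN (RP cubic decoy).** Is there a family with ALL the structure of §3 which is moreover
reflection positive along the coordinate axes (better: along the nine lattice mirrors), with
`Δ ∈ [1/2, 1]`, and still not rotation invariant? [folklore] -/
def RPCubicDecoyExists : Prop :=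
  ∃ (Δ : ℝ) (S : CorrFamily 3), Δ ∈ Set.Icc (1 / 2 : ℝ) 1 ∧ (∀ τ : Fin 3, IsReflectionPositiveAlong τ S) ∧
    (∀ n z, z ∉ NonCoincident 3 n → S n z = 0) ∧ IsNondegenerateTwoPoint S ∧
    IsTranslationInvariant S ∧ IsScaleCovariant Δ S ∧ TwoPointIsotropic S ∧ IsCubicInvariant S ∧
    IsPermutationSymmetric S ∧ ¬ IsRotationInvariant S

/-- NEAR-MISS (not closed; the ONLY `sorry` of this file). WHY IT RESISTS — every construction
tried is killed by one of two mechanisms, CONVEXITY ON THE SIMPLEX or the THRESHOLD EXPONENT: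

(i) Gaussian theories: `S₂` round ⇒ everything round (Wick). (ii) MIXTURES of centred Gaussian
theories `μ = ∫ μ_{K} dν(K)` (RP, translation and scale covariance are preserved by mixing; `U₄` of
the mixture is the `ν`-variance of `K` in Wick form, cubic if the `K` are): needs the ROUND kernel
`|x|^{-2Δ}` to be a non-trivial `ν`-average of NON-round kernels that are each reflection positive
in the three axes. (a) Components `(x·Mx)^{-Δ}` with `M` DIAGONAL (these are axis-RP: a diagonal
change of variables of the Riesz kernel, `Δ ≥ 1/2`) or mixtures of them: on the simplex `u = x̂²`
each `u ↦ (m·u)^{-Δ}` is strictly convex along every direction `d` with `m·d ≠ 0`, so a round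
(= constant on the simplex) average forces `m ∥ (1,1,1)` `ν`-a.e. — the route's own
`OneAmplitudeIsotropy` convexity; products of independent such fields die the same way by
log-convexity. (b) Non-diagonal `M`, even `B₃`-symmetrised: the partial Fourier transform
`p₁ ↦ Σ_g (p·gMgᵀp)^{Δ-3/2}` has branch points OFF the imaginary axis, not a Stieltjes function of
`p₁²` ⇒ not axis-RP. (c) Harmonic perturbations of the round kernel,
`K_ε = |x|^{-2Δ}(1 + ε Y₄^{cubic}(x̂))`: NOT axis-RP for ANY `ε ≠ 0` and any `Δ ∈ [1/2, 3/2)`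
(exact computation: `K̂_ε(p₁,q) = c₀'(s+|q|²)^{-α} + ε c₄ (s² + q₁⁴ + q₂⁴)(s+|q|²)^{-α-2}`,
`s = p₁²`, `α = 3/2 - Δ ∈ (0,1]`, Bochner–Hecke with `c₄ ≠ 0`; RP in `x₁` forces
`s ↦ K̂_ε(√s,q) = ∫ 2E dρ_q(E)/(E² + s)` to be a Stieltjes transform of a positive measure, which
can blow up at the edge `s ↓ -|q|²` of its cut at most like `(s+|q|²)^{-1}`, whereas the second term
blows up like `(s+|q|²)^{-α-2}` with non-vanishing coefficient `a² + q₁⁴ + q₂⁴`). So the round kernel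
is NOT an interior point of the axis-RP cone in the cubic-harmonic directions, and (a)–(c) leave no
Gaussian-mixture decoy. (iii) Local composites of a round GFF (`Σₖ(∂ₖ²φ)²`, `Σₖ(∂ₖφ)⁴`) are RP and
cubic but have `Δ ≥ 5/2 ∉ [1/2,1]` and non-round `S₂`. (iv) Lattice models: a `B₃`-symmetric RP
lattice model whose limit had round `S₂` but cubic `U₄` would be a scale-invariant, non-rotational,
reflection-positive fixed point with an exactly marginal spin-4 perturbation — none is known in
`d = 3` (for Ising the leading cubic operator is irrelevant, `ω_NR ≈ 2.02`, arXiv:2105.09781).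
(v) (cycle 2) `B₃`-MIXTURES REDUCE THE QUESTION TO ONE KERNEL QUESTION (Q). If `μ` is ANY axis-RP
(three coordinate mirrors), translation-invariant, scale-covariant family with two-point kernel
`K = κ(x̂)|x|^{-2Δ}` whose `B₃`-AVERAGE `(1/48)Σ_g κ∘g` is CONSTANT while `κ` is not, then the
mixture `(1/48)Σ_g g_*μ` is an RP cubic decoy: RP, translations, dilations survive mixing (each
`g_*μ` is RP in all three coordinate mirrors because `B₃` permutes them), `S₂` becomes round, and
`U₄^{mix} = avg_g U₄^{(g)} + Cov_g(S₂^{(g)}⊗S₂^{(g)})` is only `B₃` invariant. With `μ` Gaussian this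
needs exactly: (Q) a positive, continuous, even, degree `-2Δ` (`Δ ∈ [1/2,1]`) kernel, OS-positive
in the three coordinate directions, with round `B₃`-average but not round. Status of (Q): every
family tried FAILS, by three distinct mechanisms — (a) the GSM cone (mixtures of `(x·Mx)^{-Δ}`,
`M ≥ 0` diagonal; closed under `+`, `×`, `∗`; contains all products/convolutions of diagonal
quadratic-form powers and all subordinated diagonal-stable kernels `∫∏ⱼ q_t(xⱼ)dν(t)`): strict
convexity of `u ↦ (m·u)^{-Δ}` on the simplex `u = x̂²` makes a round `B₃`-average impossible;
(b) finite harmonic perturbations `K̂ = |p|^{-2α}(1 + ε H_ℓ(p)/|p|^ℓ)`, `α = 3/2-Δ`, ANY even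
harmonic `H_ℓ ≠ 0` (not only the cubic `ℓ = 4` of (ii)(c)): at transverse momentum `q` the
Stieltjes function `s = p₁² ↦ K̂` may blow up at the branch point `s ↓ -q²` at most like
`(s+q²)^{-1}`, the perturbation blows up like `(s+q²)^{-α-ℓ/2}` with coefficient `ε H_ℓ(i|q|, q)`,
and `H_ℓ(i|q|,q) ≡ 0` in `q ∈ ℝ²` forces `H_ℓ` to vanish on the complex null cone, i.e. `H_ℓ = 0`
(harmonics meet `(p·p)` trivially) — so the round kernel is NOT an interior point of the axis-RP
cone along any finite-harmonic direction; (c) anisotropic stable symbols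
`K̂ = (Σⱼ cⱼ|pⱼ|^a)^{-b}`, `a ∈ [2α, 2]`, `b = 2α/a ≤ 1` — these ARE axis-RP (`cⱼs^{a/2} + C` is
complete Bernstein, `CBF^{-b}` is Stieltjes for `b ≤ 1`), `B₃`-symmetric-or-not, continuous, in the
window (`Δ = (3-ab)/2 ∈ [1/2,1]`), and NOT diagonal-mirror RP for `a < 2` (branch points on the
positive `s`-axis; consistent with GSMRigidity needing all nine mirrors) — but positive mixtures of
them cannot have a round `B₃`-average either: near a coordinate axis `p = (1, εy)` each `a < 2`
term carries a cusp `-b c₁^{-b-1}(c₂|y₁|^a + c₃|y₂|^a)ε^a` of DEFINITE sign while `|p|^{-2α}` is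
smooth there, so all mass sits at `a = 2`, back in (a). (vi) (Q) IS SETTLED AT THE EDGE `Δ = 1/2` (`α = 1`): NO. There the round
symbol `(s₁+s₂+s₃)^{-1}` (`sⱼ = pⱼ²`) has Stieltjes measure in `s₁` the DIRAC mass at `s₂+s₃`
(spectral weight `δ(E²-q²)`); if `round = F₁ + F₂` inside the axis-RP cone then the two spectral
measures add up to it, so each is `λᵢ(s₂,s₃)δ_{s₂+s₃}` and `Fᵢ = λᵢ(s₂,s₃)/(Σs)`; the same in `s₂`
and `s₃` makes `λᵢ` constant: the round kernel spans an EXTREME RAY of the three-axis RP cone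
(coordinate mirrors only — no diagonal mirror needed), the argument passes to integrals, and hence
EVERY axis-RP scale mixture of centred Gaussian families with round `S₂` at `Δ = 1/2` has all
components round, `U₄ = (∫c² - (∫c)²)·Wick ≥ 0`, and is `O(3)` invariant (its `U₄ ≥ 0` is then
killed by the Lebowitz sign unless the mixture is trivial — the null-laplacian line's remark). For
`1/2 < Δ ≤ 1` (`α < 1`) the spectral densities `(τ-s₂-s₃)^{-α}` are absolutely continuous and can a
priori be split; (Q) becomes: find `Ψ` real-analytic on the plane `{u₁+u₂+u₃ = 1}` off the three
vertex quadrants `Qⱼ = {u_k ≤ 0, k ≠ j}` (`uⱼ = sⱼ/Σs`), bounded, non-symmetric, whose restriction to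
every real line through a vertex `Vⱼ` and the opposite open edge continues to a bounded holomorphic
function of the complexified line off the real ray beyond the vertex — three transverse pencils of
one-variable conditions on one function; additive and ratio ansätze `Σψ(u_k)`, `φ(u₂/u₃)` are forced
constant (each pencil's cut is crossed analytically by another pencil), no counterexample and no
proof yet. (vii) TWO MORE PARTIAL ANSWERS (cycle 2, later). (1) The PLANAR analogue of
(Q) is settled for EVERY `0 < α ≤ 1`: in the cone of functions on `ℝ²₊` homogeneous of degree `-α`
and Stieltjes in each variable, `(s₁+s₂)^{-α}` spans an extreme ray. Proof sketch: a summand is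
`F₁ = (s₁+s₂)^{-α}φ(s₁/(s₁+s₂))`; Stieltjes in `s₁` (at `s₂ = 1`) makes `f = (1+s)^{-α}ψ(s)` a
Stieltjes transform of `η·ρ_R`, `0 ≤ η ≤ 1`, `ρ_R = c(τ-1)^{-α}dτ` on `(1,∞)`; Stieltjes in `s₂`
is the SAME condition after the inversion `s ↦ 1/s`, and positivity of both `F₁` and `R - F₁`
across `(-1,0)` (where `R` has no jump) forces `s^{-α}f(1/s)` to be analytic across `(-1,0)`;
unwinding, `g(u) := η(1/u)ρ_R(1/u)` on `(0,1)` solves the airfoil equation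
`PV∫₀¹ g(u)(u-x)⁻¹ du - ∫₀¹ g(u)u⁻¹ du = -π cot(πα) g(x)`, i.e. `Φ(z) = ∫₀¹ g/(u-z)` solves the
Riemann–Hilbert problem `Φ₊ = e^{2πiα}Φ₋ + c₀(g)` on `[0,1]` (`c₀` the constant `∝ ∫g/u`),
`Φ(∞) = 0`, in the class `|g| ≤ C u^{α}(1-u)^{-α}` (this is `0 ≤ η ≤ 1`): general solution =
constant + `z^{α+k}(z-1)^{-α+m}P(z)` with `k, m ≥ 0` forced by the class, and `Φ(∞) = 0` forces
`k = m = deg P = 0`, so for each value of the linear functional `c₀(g)` there is at most one `g`;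
the line through `g₀ = u^{α}(1-u)^{-α}` (`η ≡ 1`) exhausts the solutions, so `η` is constant. Hence NO
two-axis Gaussian-mixture decoy exists in `d = 2` either, and in `d = 3` every summand of `R` is
`λ·(face-round)` on each coordinate face of the octant with ONE constant `λ` (edges glue the
three faces): the leaf densities `N(·; r)` tend to the constant `λ` as the leaf tends to an edge
line. (2) NO RATIONAL solutions in `d = 3`: if `F₁ = R·P(s)/Q(s)` with `P, Q` homogeneous
polynomials then `Q` may vanish only where some pencil allows a cut, i.e. `Q(z, s₂, s₃) = 0`,
`s₂, s₃ > 0` forces `z` real `≤ -(s₂+s₃)`, and cyclically; restricting to a face (`s₃ → 0`) the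
binary form `Q(s₁, s₂, 0)` has all root ratios `≤ -1` from one pencil and `≥ -1` from the other,
so it is `(s₁+s₂)^d`, whence `Q = e₁^d + s₁s₂s₃Q'` and `y ↦ Q(-(s₂+s₃)-y, s₂, s₃) = ±y^d + O(y^{d-2})`
has `d` non-negative roots summing to `0`: `Q = (Σs)^d`, `F₁ = R·(polynomial in u)`, and the edge
blow-up of (b) leaves only constants. So a solution of (Q), if any, is transcendental with genuine
cuts on all three pencils, not separable (`Σψ(u_k)`, `Πg_k(u_k)`, `φ(u₂/u₃)` are forced entire,
hence constant, because each pencil's cut region is crossed analytically by another pencil).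
(3) NUMERICS (exact active-set NNLS, `q_nnls_local.py`
attached to the item; farm copy `q_nnls.py`, job j013190): over a dictionary of 245 explicit
members of the three-axis RP cone — `S₃`-symmetrised atoms `L(s)^{-α}`, `L` a nonnegative
combination of the complete-Bernstein monomials `sⱼ, √(sᵢsⱼ), (s₁s₂s₃)^{1/3}`, and products
`L₁^{-β}L₂^{-(α-β)}` — on a 109-point grid of the simplex (interior + near-edge + near-vertex),
the non-negative least-squares projection of ROUND onto the cone spanned by the atoms at
parameter-anisotropy `≥ τ` is attained by a SINGLE atom (the residual after the nearest atom is
negatively correlated with every other column: KKT-optimal with one active ray), with relative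
residual `3.2/2.7/2.1/1.5 %` at `τ = 0.15` and `6.7/5.8/4.5/3.4 %` at `τ = 0.4` for
`α = 1/0.9/0.75/0.6` — the control `α = 1` (provably NO) behaves exactly like `α < 1`, the decrease
in `α` being the flattening of `L^{-α}`; with the round atom admitted the fit is exact (`1e-16`).
So inside this class ROUND is an exposed ray for every `α`: mixing anisotropic axis-RP atoms never
beats the nearest single atom (every such atom satisfies `Sym F ≥ κ_F·R` pointwise by the
power-mean and weighted AM–GM inequalities, equality iff round). Weak, dictionary-limited
evidence for NO on `1/2 < Δ ≤ 1`; a transcendental solution with genuine cuts is not excluded.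
NB the axis-RP cone is STRICTLY larger than the GSM cone already at `α = 1`:
`1/(√(s₁s₂) + s₃)` is Stieltjes in each variable (`√(s₁s₂)+s₃` is complete Bernstein in each) but
not completely monotone (`∂₁∂₂` changes sign at `s₃ = √(s₁s₂)`), so the convexity obstruction (a)
does not exhaust (Q). So (Q) is open exactly on `1/2 < Δ ≤ 1` and sharp: a YES kills every
"axis-RP + `B₃` + round `S₂` ⇒ `O(3)`" line by a GAUSSIAN-mixture decoy; a NO for the nine-mirror
version is essentially the sibling crux `GSMRigidity`/`HRP2Rigidity` extended off the GSM cone.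
CONSEQUENCE: a decoy here must be a genuinely interacting non-Gaussian RP family, or come from (Q);
its construction would kill every "RP + B₃ + round S₂ ⇒ O(3)" line at once, its non-existence in
the RP class would essentially prove the crux model-blindly for RP families. The picked line
`two-crystals-generate-so3` (§5) uses NO reflection positivity and is untouched either way. [folklore] -/
theorem rpCubicDecoy : RPCubicDecoyExists := by
  sorry

/-! ## §5 Targets — the PICKED line `two-crystals-generate-so3` (cycle 2)

The lead (`prover-line-stmt-CriticalPhenomena-8367-0`) picked `two-crystals-generate-so3`
(`PICKED.md`, 2026-08-16T03:09Z) and registered the reshaped skeleton `589b0f0d500a` (03:24Z) with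
SEVEN stubs (signatures: `ledger workitem get stmt-CriticalPhenomena-8367 --json`, `.stubs`; the
tree copy `Lines/two-crystals-generate-so3.lean` is still the 4-stub gen-1 skeleton). Payload
`targets`/`stuck_stubs` were empty at arm time, so ALL seven were attacked as targets. Verdicts:

| stub | verdict of the disprover | evidence |
|---|---|---|
| `stub_hexStackUniversality` (bridge, OPEN; symmetric gauge `L_c x = (x₀+x₁/2, (√3/2)x₁, c x₂)`) | RESISTS — unfalsifiable here: it is 3D inter-lattice universality `(ℤ³, T)`; no junk found | below, (B) |
| `stub_hexPlusStateSixfold` (`M̃`-invariance of the `T` plus state, `β ≥ 0`) | TRUE as typed | (S1) |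
| `stub_latticeSymmetryTransport` (`GL_d(ℤ)` symmetries pass to continuous limits) | TRUE as typed | (S2) |
| `stub_arccosQuarter` (`m·arccos(-1/4) ∉ 2πℤ`, `m ≠ 0`) | TRUE — PROVED (`arccosQuarter`, Mathlib `niven`); candidate proof attached as item evidence | below |
| `stub_twistIdentities` (`W R_θ W = R_z30 R_x90 R_z30`, `R_c W R_z(φ) W R_c⁻¹ = W R_x(φ) W`) | TRUE — both identities verified numerically (exact-arithmetic-free check at 13 angles, residual < 1e-9; the second is linear in `(cos φ, sin φ, 1)` so 3 angles decide it) | NOTES |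
| `stub_circleClosed` (one irrational rotation of a continuous circle group ⇒ the whole circle) | TRUE; TIGHT: irrationality AND continuity of `S` are each load-bearing | `stubCircleClosed_false_without_irrational`, `stubCircleClosed_false_without_continuity` below |
| `stub_rotationsFromTwoCircles` (two conjugate circles + the mirror `F` ⇒ `O(3)`) | TRUE (Euler `z-x-z`; `F` supplies `det = -1`); `F` is load-bearing only against pseudoscalar families (`S₃ = det`), and is free for limits (`signFlip_free`) | — |

So: 7 targets, 0 broken; the line's open content is exactly the bridge.

(S1) `M̃ = !![0,-1,0;1,1,0;0,0,1]` IS a graph automorphism of `T` fixing `0` (bond set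
`{±e₀, ±e₁, ±e₂, ±(e₀−e₁)} ↦ {±e₁, ∓(e₀−e₁), ±e₂, ±e₀}`, `det M̃ = 1`); for `β ≥ 0`, `h = 0`, plus
b.c., `Λ ↦ ⟨σ_A⟩⁺_Λ` is antitone (tree `isingExpect_fixed_anti_volume`), cubic boxes and sheared boxes
`M̃⁻¹(box L)` are both cofinal, so both `limUnder`s equal the infimum over all finite volumes and
`isingExpect_fixed_relabel` identifies them. No junk: `limUnder` of a convergent sequence. For
`β < 0` (frustrated antiferromagnet on triangular layers) the statement would hinge on the uniform
junk value of `limUnder` — correctly excluded by `0 ≤ β`.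
(S2) `⌊M(y)⌋ = M⌊y⌋ + r`, `r ∈ ℤ^{d}` bounded by `Σₖ|M_{jk}|`; `M`-invariance and `N = M⁻¹ ∈ GL_d(ℤ)`
turn the rescaled correlator at `Mx` into the one at `x + δ N r(δ,x)`; local uniformity at `x` plus
continuity of `S n` AT `x` finish (`M` injective preserves `NonCoincident`; `d = 0` trivial). Only
continuity at the point `x` is used. Is continuity droppable altogether? No counterexample found
(explored `d ≤ 2`, `n ≤ 2`: an `M`-invariant lattice family whose step-limit jumps exactly where the
rounding defect `N r` points across the jump seems not to exist, because local uniform convergence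
of cell-step functions forces floor-compatible ("right-continuous") jumps only across coordinate
hyperplanes through `0`, and `M`-invariance of `G` then forces the defect to vanish in the jumping
coordinate) — recorded as "continuity possibly unnecessary", harmless since continuity is FREE for
the crux's instances (§1 `limit_continuousOn`).

(B) THE BRIDGE `stub_hexStackUniversality` (registered form): for every instance `(ρ, S)` of
(H1)–(H4), `∃ ρ' > 0 on (0,1], ∃ c > 0`, `HasPointwiseScalingLimit stCriticalCorr ρ' (S ∘ L_c)`.
* No junk in the `T`-side objects: `stPlusExpect β` converges on spin monomials for `β ≥ 0` (GKS
  volume antitonicity on any locally finite graph); `stCriticalBeta = sInf {β ≥ 0 | m*_T(β) > 0}` is a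
  genuine number in `[0, β_c(3)]` (`T ⊇ ℤ³` bondwise, GKS in the couplings ⇒ `m*_T ≥ m*_{ℤ³}`, so the
  set is non-empty; bounded below by `0`); order `0` is consistent (`⟨1⟩ = 1 = S₀`, §2).
* What it CONTAINS (each believed, none proved, none refutable without constructing the `T` limit):
  full-filter existence of the critical `T` scaling limit; `m*_T(β_c(T)) = 0` (else `n = 1` forces
  `ρ' → 0` and `n = 2` contradicts (H4)); `Δ_T = Δ`; and that the anisotropy ellipsoid of critical `T`
  is EXACTLY the equilateral-hexagonal in-plane metric with one free axial ratio `c` — forced by the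
  sixfold symmetry IF the common limit is `O(3)` invariant. Logically the symmetric gauge is part of
  the open claim: from the weak form "`T`-limit `= S ∘ A` for SOME `A ∈ GL₃(ℝ)`" the form `A = λ Q L_c`
  follows only via `A·P_T·A⁻¹ ⊂ Stab(S)` and `Stab(S) = O(3)`; with `Stab(S) ⊇ B₃` alone, `AᵀA` need
  not be `P_T`-invariant. (Physically harmless; the gauge buys `g = L_c M̃ L_c⁻¹ = R_z(60°)` on the nose —
  checked: `L_c M̃ L_c⁻¹ = !![1/2,-√3/2,0; √3/2,1/2,0; 0,0,1]` for every `c`.)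
* (H7) IS UNUSED by the line even in a general gauge: if `S ∘ L` is the `T`-limit for some
  `L ∈ GL₃(ℝ)`, then `g = L M̃ L⁻¹` fixes `K = S₂(0,·)`, and `Stab(K) = {A ∈ GL₃ | K ∘ A = K}` is
  COMPACT (K continuous, positive, homogeneous of degree `-2Δ < 0` ⇒ `m‖x‖^{-2Δ} ≤ K ≤ M‖x‖^{-2Δ}`
  ⇒ `‖A‖, ‖A⁻¹‖ ≤ (M/m)^{1/2Δ}`) and contains `B₃`, hence preserves a `B₃`-invariant inner product,
  which is Euclidean: `Stab(K) ⊂ O(3)`, so `g` is an isometry with no roundness input. Consequence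
  for planners: this line proves the (H7)-free `HyperoctahedralRP.LimitRotationInvariant` as well;
  the bridge is at least as strong as full isotropy of the Ising₃ limit (expected: universality
  between two lattices is the stronger physical statement). Not a defect of the line — a measure of
  where ALL the difficulty sits.
* Literature: rotation/universality for stacked-triangular Ising is numerically standard (3D Ising
  class) and rigorously open like everything 3D; the continuity input `m*_T(β_c(T)) = 0` would need the
  Aizenman–Duminil-Copin–Sidoravicius infrared-bound route, i.e. reflection positivity of `T`: the
  `T` couplings ARE reflection positive for the hexagonal mirrors (site mirrors along `a₁`, mixed
  mirrors perpendicular to `a₁` whose crossing bonds join mirror pairs, and both `e₂` mirror types),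
  but NOT for the cubic coordinate mirrors `x₀ ↦ -x₀` (the bond `e₀ - e₁` maps to the non-bond
  `-e₀ - e₁`): any RP argument on `T` must use the hexagonal frames.

### Lean content of this section
`Rz φ` (rotations about `e₂` as `LinearIsometryEquiv`s, group law, continuity), the registered stub
`stub_circleClosed` verbatim (`StubCircleClosed`) with its two weakenings refuted, and the proof of
`stub_arccosQuarter` (`arccosQuarter`, via Mathlib's `niven`). Landed/queued copies:
`Theorems/RotationUpgradeFromTwoPoint/Negative/CircleClosedTightness.lean` (negative lemmas);
`StubArccosQuarter.lean` attached as item evidence (positive ⇒ a prover/the lead lands it).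
-/

/-! ### The rotations about the third coordinate axis -/

/-- Rotation by `φ` about the `x₂`-axis, as a linear map of `ℝ³`. [folklore] -/
def rzLin (φ : ℝ) : E³ →ₗ[ℝ] E³ where
  toFun x := WithLp.toLp 2
    ![Real.cos φ * x 0 - Real.sin φ * x 1, Real.sin φ * x 0 + Real.cos φ * x 1, x 2]
  map_add' x y := by
    ext j
    fin_cases j <;> simp <;> ring
  map_smul' c x := by
    ext j
    fin_cases j <;> simp <;> ring

/-- Unfolding of `rzLin`. [folklore] -/
theorem rzLin_apply (φ : ℝ) (x : E³) :
    rzLin φ x = WithLp.toLp 2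
      ![Real.cos φ * x 0 - Real.sin φ * x 1, Real.sin φ * x 0 + Real.cos φ * x 1, x 2] := rfl

/-- `rzLin φ` preserves the Euclidean norm. [folklore] -/
theorem norm_rzLin (φ : ℝ) (x : E³) : ‖rzLin φ x‖ = ‖x‖ := by
  rw [EuclideanSpace.norm_eq, EuclideanSpace.norm_eq]
  congr 1
  simp only [Fin.sum_univ_three, rzLin_apply, Real.norm_eq_abs, sq_abs, PiLp.toLp_apply,
    Matrix.cons_val_zero, Matrix.cons_val_one, Matrix.cons_val]
  linear_combination (x 0 ^ 2 + x 1 ^ 2) * Real.sin_sq_add_cos_sq φ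

/-- Rotation by `φ` about the `x₂`-axis, as a linear isometry. [folklore] -/
def rzIso (φ : ℝ) : E³ →ₗᵢ[ℝ] E³ := ⟨rzLin φ, norm_rzLin φ⟩

/-- **`Rz φ`**: rotation by `φ` about the `x₂`-axis as a linear isometry equivalence — the
one-parameter group `T` of `stub_circleClosed` / the `Rz` of `stub_rotationsFromTwoCircles`. [folklore] -/
def Rz (φ : ℝ) : E³ ≃ₗᵢ[ℝ] E³ := (rzIso φ).toLinearIsometryEquiv rfl

/-- Unfolding of `Rz` (it has the coordinate form demanded by `stub_rotationsFromTwoCircles`). [folklore] -/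
theorem Rz_apply (φ : ℝ) (x : E³) :
    Rz φ x = WithLp.toLp 2
      ![Real.cos φ * x 0 - Real.sin φ * x 1, Real.sin φ * x 0 + Real.cos φ * x 1, x 2] := rfl

/-- Coordinate `0` of `Rz φ x`. [folklore] -/
@[simp] theorem Rz_apply_zero (φ : ℝ) (x : E³) : Rz φ x 0 = Real.cos φ * x 0 - Real.sin φ * x 1 := by
  simp [Rz_apply]

/-- Coordinate `1` of `Rz φ x`. [folklore] -/
@[simp] theorem Rz_apply_one (φ : ℝ) (x : E³) : Rz φ x 1 = Real.sin φ * x 0 + Real.cos φ * x 1 := by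
  simp [Rz_apply]

/-- Coordinate `2` of `Rz φ x`. [folklore] -/
@[simp] theorem Rz_apply_two (φ : ℝ) (x : E³) : Rz φ x 2 = x 2 := by
  simp [Rz_apply]

/-- Group law: `Rz (φ + ψ) = Rz φ ∘ Rz ψ`. [folklore] -/
theorem Rz_add (φ ψ : ℝ) (x : E³) : Rz (φ + ψ) x = Rz φ (Rz ψ x) := by
  ext j
  fin_cases j
  · simp [Real.cos_add, Real.sin_add]
    ring
  · simp [Real.cos_add, Real.sin_add]
    ring
  · simp

/-- `Rz 0 = 1`. [folklore] -/
theorem Rz_zero (x : E³) : Rz 0 x = x := by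
  ext j
  fin_cases j <;> simp

/-- `Rz (2π) = 1`. [folklore] -/
theorem Rz_two_pi (x : E³) : Rz (2 * Real.pi) x = x := by
  ext j
  fin_cases j <;> simp

/-- `Rz (-φ)` undoes `Rz φ`. [folklore] -/
theorem Rz_neg_apply (φ : ℝ) (x : E³) : Rz (-φ) (Rz φ x) = x := by
  rw [← Rz_add, neg_add_cancel, Rz_zero]

/-- The orbit maps `φ ↦ Rz φ x` are continuous. [folklore] -/
theorem continuous_Rz (x : E³) : Continuous fun φ => Rz φ x := by
  simp only [Rz_apply]
  refine (PiLp.continuous_toLp 2 _).comp (continuous_pi fun j => ?_)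
  fin_cases j
  · simp only [Fin.zero_eta, Matrix.cons_val_zero]
    exact (Real.continuous_cos.mul continuous_const).sub (Real.continuous_sin.mul continuous_const)
  · simp only [Fin.mk_one, Matrix.cons_val_one, Matrix.cons_val_zero]
    exact (Real.continuous_sin.mul continuous_const).add (Real.continuous_cos.mul continuous_const)
  · exact continuous_const

/-- The quarter turn `Rz (π/2) (a, b, c) = (-b, a, c)` — a lattice rotation (element of `B₃`).
[folklore] -/
theorem Rz_pi_div_two (x : E³) : Rz (Real.pi / 2) x = WithLp.toLp 2 ![-x 1, x 0, x 2] := by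
  ext j
  fin_cases j <;> simp

/-- `sin (arccos (3/5)) = 4/5`. [folklore] -/
theorem sin_arccos_three_fifths : Real.sin (Real.arccos (3 / 5)) = 4 / 5 := by
  rw [Real.sin_arccos]
  have h : (1:ℝ) - (3 / 5) ^ 2 = (4 / 5) ^ 2 := by norm_num
  rw [h, Real.sqrt_sq (by norm_num)]

/-- `cos (arccos (3/5)) = 3/5`. [folklore] -/
theorem cos_arccos_three_fifths : Real.cos (Real.arccos (3 / 5)) = 3 / 5 :=
  Real.cos_arccos (by norm_num) (by norm_num)

/-- The RATIONAL rotation `Rz (arccos (3/5))` maps `t e₀` to `t u`, `u = (3/5, 4/5, 0)`: on the axis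
it agrees with the reflection `R₀` of §3. [folklore] -/
theorem Rz_arccos_axisPt (t : ℝ) : Rz (Real.arccos (3 / 5)) (axisPt t) = t • uDir := by
  ext j
  fin_cases j <;>
    simp [axisPt, axisUnit, uDir, sin_arccos_three_fifths, cos_arccos_three_fifths]

/-- Hence `Rz (arccos (3/5))` and `R₀` agree on the collinear test quadruple `configU4`. [folklore] -/
theorem Rz_arccos_configU4 :
    (fun i => Rz (Real.arccos (3 / 5)) (configU4 i)) = fun i => R₀ (configU4 i) := by
  rw [R₀_configU4]
  funext i
  fin_cases i <;> simp [configU4, Rz_arccos_axisPt]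

/-- The sign pattern `(1, -1, 1)`. [folklore] -/
def epsFlip1 : Fin 3 → ℤˣ := ![1, -1, 1]

/-- `R_ε := P_swap⁻¹ ∘ Rz (π/2)` (with `P_swap` the coordinate swap `0 ↔ 1`) satisfies the sign-flip
equations with `ε = (1, -1, 1)`, i.e. `Rz (π/2) = P_swap ∘ R_ε ∈ B₃`. [folklore] -/
theorem swap_symm_Rz_pi_div_two_apply (p : E³) (j : Fin 3) :
    ((Rz (Real.pi / 2)).trans
        (LinearIsometryEquiv.piLpCongrLeft 2 ℝ ℝ (Equiv.swap (0 : Fin 3) 1)).symm) p j =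
      ((epsFlip1 j : ℤ) : ℝ) * p j := by
  rw [LinearIsometryEquiv.trans_apply, LinearIsometryEquiv.piLpCongrLeft_symm, coordPerm_apply]
  fin_cases j
  · simp [epsFlip1, Equiv.swap_apply_def]
  · simp [epsFlip1, Equiv.swap_apply_def]
  · have h2 : (Equiv.swap (0 : Fin 3) 1) 2 = 2 := by decide
    simp [epsFlip1, h2]

/-- The cubic decoy is invariant under the quarter turn `Rz (π/2)` (`B₃` invariance, §3). [folklore] -/
theorem cubicFamily_Rz_pi_div_two (Δ : ℝ) (n : ℕ) (x : Fin n → E³) :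
    cubicFamily Δ n (fun i => Rz (Real.pi / 2) (x i)) = cubicFamily Δ n x := by
  set P := LinearIsometryEquiv.piLpCongrLeft 2 ℝ ℝ (Equiv.swap (0 : Fin 3) 1) with hP
  set Rε := (Rz (Real.pi / 2)).trans P.symm with hRε
  have hcfg : (fun i => Rz (Real.pi / 2) (x i)) = fun i => P (Rε (x i)) := by
    funext i
    simp [hRε]
  rw [hcfg, (cubicFamily_isCubicInvariant Δ).1 _ n (fun i => Rε (x i))]
  exact (cubicFamily_isCubicInvariant Δ).2 epsFlip1 Rε (fun p j => swap_symm_Rz_pi_div_two_apply p j) n x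

/-! ### `stub_circleClosed`: registered form and its two load-bearing clauses -/

/-- Registered stub `stub_circleClosed` (skeleton `589b0f0d500a`), VERBATIM. TRUE (closed subgroup
of `ℝ` containing `θ₀` and `2π`); not a target any more. [folklore] -/
def StubCircleClosed : Prop :=
  ∀ (S : CorrFamily 3) (T : ℝ → (E³ ≃ₗᵢ[ℝ] E³)) (θ₀ : ℝ),
    (∀ n, ContinuousOn (S n) (NonCoincident 3 n)) →
    (∀ n z, z ∉ NonCoincident 3 n → S n z = 0) →
    (∀ φ ψ x, T (φ + ψ) x = T φ (T ψ x)) → (∀ x, Continuous fun φ => T φ x) →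
    (∀ x, T (2 * Real.pi) x = x) →
    (∀ m k : ℤ, m ≠ 0 → (m : ℝ) * θ₀ ≠ (k : ℝ) * (2 * Real.pi)) →
    (∀ (n : ℕ) (x : Fin n → E³), S n (fun i => T θ₀ (x i)) = S n x) →
    ∀ (φ : ℝ) (n : ℕ) (x : Fin n → E³), S n (fun i => T φ (x i)) = S n x

/-- The stub with the IRRATIONALITY clause deleted. [folklore] -/
def StubCircleClosedWithoutIrrational : Prop :=
  ∀ (S : CorrFamily 3) (T : ℝ → (E³ ≃ₗᵢ[ℝ] E³)) (θ₀ : ℝ),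
    (∀ n, ContinuousOn (S n) (NonCoincident 3 n)) →
    (∀ n z, z ∉ NonCoincident 3 n → S n z = 0) →
    (∀ φ ψ x, T (φ + ψ) x = T φ (T ψ x)) → (∀ x, Continuous fun φ => T φ x) →
    (∀ x, T (2 * Real.pi) x = x) →
    (∀ (n : ℕ) (x : Fin n → E³), S n (fun i => T θ₀ (x i)) = S n x) →
    ∀ (φ : ℝ) (n : ℕ) (x : Fin n → E³), S n (fun i => T φ (x i)) = S n x

/-- The stub with CONTINUITY OF `S` deleted. [folklore] -/
def StubCircleClosedWithoutContinuity : Prop :=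
  ∀ (S : CorrFamily 3) (T : ℝ → (E³ ≃ₗᵢ[ℝ] E³)) (θ₀ : ℝ),
    (∀ n z, z ∉ NonCoincident 3 n → S n z = 0) →
    (∀ φ ψ x, T (φ + ψ) x = T φ (T ψ x)) → (∀ x, Continuous fun φ => T φ x) →
    (∀ x, T (2 * Real.pi) x = x) →
    (∀ m k : ℤ, m ≠ 0 → (m : ℝ) * θ₀ ≠ (k : ℝ) * (2 * Real.pi)) →
    (∀ (n : ℕ) (x : Fin n → E³), S n (fun i => T θ₀ (x i)) = S n x) →
    ∀ (φ : ℝ) (n : ℕ) (x : Fin n → E³), S n (fun i => T φ (x i)) = S n x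

/-- **The irrationality clause of `stub_circleClosed` is load-bearing.** Witness `T = Rz`,
`θ₀ = π/2`, `S = cubicFamily 1`, moved by the rational rotation `Rz (arccos (3/5))` exactly as by
`R₀` on `configU4` (§3 `cubicFamily_four_R₀_ne`). [folklore] -/
theorem stubCircleClosed_false_without_irrational : ¬ StubCircleClosedWithoutIrrational := by
  intro h
  have key := h (cubicFamily 1) Rz (Real.pi / 2) (continuousOn_cubicFamily 1)
    (cubicFamily_eq_zero_of_not_mem one_ne_zero) Rz_add continuous_Rz Rz_two_pi
    (cubicFamily_Rz_pi_div_two 1) (Real.arccos (3 / 5)) 4 configU4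
  rw [Rz_arccos_configU4] at key
  exact cubicFamily_four_R₀_ne 1 key

/-- The orbit `{Rz k e₀ | k ∈ ℤ}` of the axis unit vector under the powers of the one-radian
rotation. [folklore] -/
def unitOrbit : Set E³ := Set.range fun k : ℤ => Rz (k : ℝ) axisUnit

open Classical in
/-- The orbit indicator at order one (all other orders zero). [folklore] -/
def orbitFamily : CorrFamily 3 := fun n =>
  match n with
  | 1 => fun x => if x 0 ∈ unitOrbit then 1 else 0
  | _ => fun _ => 0

/-- The orbit is `Rz 1`-stable in both directions. [folklore] -/
theorem Rz_one_mem_unitOrbit_iff (y : E³) : Rz 1 y ∈ unitOrbit ↔ y ∈ unitOrbit := by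
  constructor
  · rintro ⟨k, hk⟩
    have hk' : Rz (k : ℝ) axisUnit = Rz 1 y := hk
    refine ⟨k - 1, ?_⟩
    show Rz ((k - 1 : ℤ) : ℝ) axisUnit = y
    have hcast : ((k - 1 : ℤ) : ℝ) = -1 + (k : ℝ) := by push_cast; ring
    rw [hcast, Rz_add, hk', Rz_neg_apply]
  · rintro ⟨k, hk⟩
    have hk' : Rz (k : ℝ) axisUnit = y := hk
    refine ⟨k + 1, ?_⟩
    show Rz ((k + 1 : ℤ) : ℝ) axisUnit = Rz 1 y
    have hcast : ((k + 1 : ℤ) : ℝ) = 1 + (k : ℝ) := by push_cast; ring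
    rw [hcast, Rz_add, hk']

/-- `θ₀ = 1` radian is an irrational angle: `m ≠ 2πk` for `m ≠ 0` (`irrational_pi`). [folklore] -/
theorem one_radian_irrational (m k : ℤ) (hm : m ≠ 0) : (m : ℝ) * 1 ≠ (k : ℝ) * (2 * Real.pi) := by
  intro h
  rw [mul_one] at h
  by_cases hk : k = 0
  · rw [hk, Int.cast_zero, zero_mul] at h
    exact hm (by exact_mod_cast h)
  · have hk2 : ((2 * k : ℤ) : ℝ) ≠ 0 := by
      push_cast
      exact mul_ne_zero two_ne_zero (Int.cast_ne_zero.mpr hk)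
    have hpi : Real.pi = (m : ℝ) / ((2 * k : ℤ) : ℝ) := by
      rw [eq_div_iff hk2, h]
      push_cast
      ring
    exact irrational_pi.ne_rational m (2 * k) hpi

/-- `e₀` lies on the orbit. [folklore] -/
theorem axisUnit_mem_unitOrbit : axisUnit ∈ unitOrbit := by
  refine ⟨0, ?_⟩
  show Rz ((0 : ℤ) : ℝ) axisUnit = axisUnit
  rw [Int.cast_zero, Rz_zero]

/-- `Rz (π/2) e₀ = e₁` is NOT on the orbit (`sin k = 1` would make `π` rational). [folklore] -/
theorem Rz_pi_div_two_axisUnit_not_mem : Rz (Real.pi / 2) axisUnit ∉ unitOrbit := by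
  rintro ⟨k, hk⟩
  have hk' : Rz (k : ℝ) axisUnit = Rz (Real.pi / 2) axisUnit := hk
  have h1 : Rz (k : ℝ) axisUnit 1 = Rz (Real.pi / 2) axisUnit 1 := by rw [hk']
  simp [axisUnit] at h1
  obtain ⟨m, hm⟩ := Real.sin_eq_one_iff.1 h1
  have hk0 : k ≠ 0 := by
    rintro rfl
    simp at h1
  have key : ((4 * k : ℤ) : ℝ) * 1 = ((1 + 4 * m : ℤ) : ℝ) * (2 * Real.pi) := by
    push_cast
    rw [← hm]
    ring
  exact one_radian_irrational (4 * k) (1 + 4 * m) (by omega) key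

/-- Every configuration of ONE point is non-coincident. [folklore] -/
theorem mem_nonCoincident_one (z : Fin 1 → E³) : z ∈ NonCoincident 3 1 := by
  rw [mem_nonCoincident]
  exact Function.injective_of_subsingleton z

/-- The orbit family is normalised. [folklore] -/
theorem orbitFamily_norm (n : ℕ) (z : Fin n → E³) (hz : z ∉ NonCoincident 3 n) : orbitFamily n z = 0 := by
  match n, z, hz with
  | 0, _, _ => rfl
  | 1, z, hz => exact absurd (mem_nonCoincident_one z) hz
  | (n + 2), _, _ => rfl

open Classical in
/-- The orbit family is `Rz 1` invariant. [folklore] -/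
theorem orbitFamily_Rz_one (n : ℕ) (x : Fin n → E³) :
    orbitFamily n (fun i => Rz 1 (x i)) = orbitFamily n x := by
  match n, x with
  | 0, _ => rfl
  | 1, x =>
    show (if Rz 1 (x 0) ∈ unitOrbit then (1:ℝ) else 0) = if x 0 ∈ unitOrbit then 1 else 0
    rw [Rz_one_mem_unitOrbit_iff]
  | (n + 2), _ => rfl

open Classical in
/-- … but not `Rz (π/2)` invariant (order one, the point `e₀`). [folklore] -/
theorem orbitFamily_Rz_pi_div_two_ne :
    orbitFamily 1 (fun i => Rz (Real.pi / 2) ((![axisUnit] : Fin 1 → E³) i)) ≠ orbitFamily 1 ![axisUnit] := by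
  show (if Rz (Real.pi / 2) ((![axisUnit] : Fin 1 → E³) 0) ∈ unitOrbit then (1:ℝ) else 0) ≠
    if (![axisUnit] : Fin 1 → E³) 0 ∈ unitOrbit then 1 else 0
  simp only [Matrix.cons_val_fin_one]
  rw [if_neg Rz_pi_div_two_axisUnit_not_mem, if_pos axisUnit_mem_unitOrbit]
  norm_num

/-- **Continuity of `S` in `stub_circleClosed` is load-bearing** (witness `Rz`, `θ₀ = 1`,
`orbitFamily`, moved by `Rz (π/2)`). Free for the crux (§1 `limit_continuousOn`), but the stub
cannot be weakened. [folklore] -/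
theorem stubCircleClosed_false_without_continuity : ¬ StubCircleClosedWithoutContinuity := by
  intro h
  exact orbitFamily_Rz_pi_div_two_ne (h orbitFamily Rz 1 orbitFamily_norm Rz_add continuous_Rz
    Rz_two_pi one_radian_irrational orbitFamily_Rz_one (Real.pi / 2) 1 ![axisUnit])

/-! ### `stub_arccosQuarter` holds (Niven) -/

/-- **Registered stub `stub_arccosQuarter`, PROVED**: `m · arccos (-1/4) ≠ 2πk` for `m ≠ 0`, by
Mathlib's `niven` (a rational multiple of `π` with rational cosine has cosine in
`{-1,-1/2,0,1/2,1} ∌ -1/4`). Positive, hence only evidence from this seat (`StubArccosQuarter.lean`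
attached to the item). [folklore] -/
theorem arccosQuarter (m k : ℤ) (hm : m ≠ 0) :
    (m : ℝ) * Real.arccos (-1 / 4) ≠ (k : ℝ) * (2 * Real.pi) := by
  intro h
  set θ : ℝ := Real.arccos (-1 / 4) with hθdef
  have hm' : (m : ℝ) ≠ 0 := Int.cast_ne_zero.mpr hm
  have hθ : ∃ r : ℚ, θ = r * Real.pi := by
    refine ⟨2 * k / m, ?_⟩
    push_cast
    field_simp
    linarith [h]
  have hcosval : Real.cos θ = -1 / 4 := Real.cos_arccos (by norm_num) (by norm_num)
  have hcos : ∃ q : ℚ, Real.cos θ = q := ⟨-1 / 4, by rw [hcosval]; push_cast; ring⟩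
  have key := niven hθ hcos
  rw [hcosval] at key
  simp only [Set.mem_insert_iff, Set.mem_singleton_iff] at key
  norm_num at key


end Summit.CriticalPhenomena.Ising3DConformalLimit.Cruxes.RotationUpgradeFromTwoPoint.Disproof

end
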